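import Literature.NumberTheory.Rogawski1990.ArchCentralLimitNoncompactWallFirstJetCM    -- ★ p843187 (A-p18): (J-nc) at the wall points (`archLimitFormulaNoncompactWall_holds` packaging), wall geometry ★ p843058, `cos`-facts
import Literature.NumberTheory.Rogawski1990.ArchLimitFormulaNoncompactWallThirdJet      -- ★ p844137 (A-p18, road Z): `wall02_cubeLimit`
import Literature.NumberTheory.Rogawski1990.ArchCentralLimitFormulaOfWallValues         -- ★ p844011 (F0P3a-p02 (g13)): `perm_fin_three_cases`, `cos_three_mul_ne_one_of_abs_lt`; brings the chamber∕socket stack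
import Literature.NumberTheory.Rogawski1990.ArchCentralLimitJetBoundsOfBootstrap        -- ★ p846633 (F0P3a-p02 (g15), (f1)): `letterJetBound_of_liePhiJetBounds`, `ArchCentralLimitFormulaRankTwo.of_liePhiJetBounds_of_values`
import Literature.NumberTheory.Rogawski1990.ArchCentralLimitChamberValueMax            -- ★ p846689 ((f2) FILE 2, this seat): `iteratedFDeriv_neg_comp_neg`, `neg_compContinuousLinearMap_neg_apply_const_three`, `continuous_neg_compContinuousLinearMap_neg`; brings ★ CornerValueInversion (`Θ^∨`)
import Literature.Analysis.Calculus.ConvexCornerJetTransfer                             -- (f2) FILE 3a (this seat): `cornerJet_transfer`, boundary limits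
import HarnessLib

/-!
# ROAD «A6-IV» brick (f2), FILE 3b — THE VALUE OF A CORNER JET LIMIT ON THE DOUBLY-NONCOMPACT CHAMBER `S⁻ = {θ₁ < θ₂ < θ₀}` from its compact-adjacent neighbour across the wall `θ₀ = θ₂`
# (Rogawski 1990 §8.4 pp. 126–127, §8.2 p. 119; Harish-Chandra: odd normal derivatives of `F_f` are continuous across a noncompact wall — Varadarajan 1989 §6.4 Thms 17, 22)

Topic `NumberTheory/Rogawski1990`; namespace `Literature.NumberTheory.Rogawski1990` (§1 generic in `Literature.Analysis.Calculus`).  THEOREMS ONLY (no `def`, no instance, no notation, no axiom,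
no named fact, no `sorry`).  Cell `pub/hodgecm-mathlib`, ENGINE T1 (crux H413 = `stmt-HodgeConjecture-24833`); ROAD A, design of record `DESIGN-A6-InHouse-v2-ArchitectureIV` 93542b84 §2 (f2)
(owner∕architect F0P3a-p05 (g15), R-15.10 (1) «(f1)(f2) = p02»); pen F0P3a-p02 (g15), 2026-09-01.  FILE 1 `…ChamberValueMin` ★ p846676 (θ₂-minimal pair), FILE 2 `…ChamberValueMax` (θ₂-maximal
pair), FILE 3a `ConvexCornerJetTransfer` (generic corner transfer in jet form).

THE MATHEMATICS (jet form of ★ (h4) `lambda8Angle_zero_eq_of_wall02_oddJets_of_isOpen` + ★ (J3-odd)₁∕₃).  The chamber `S⁻ = {θ₁<θ₂<θ₀}` and the compact-adjacent `D = {θ₁<θ₀<θ₂}` (θ₂-maximal)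
share the half-wall `{tA′ : t > 0}` of `θ₀ = θ₂` (`A′ = (1,−2,1)`, normal `N′ = (1,0,−1)`; the normal line `tA′ + sN′` is in `S⁻` for small `s > 0`, in `D` for small `s < 0`, ★ p843058).  Given
the (d2)+(f1) output on both chambers — `F_Θ∘chart_ζ` of class `C⁴` with BOUNDED FOURTH JET on `C ∩ B(0,r)` — FILE 3a's `cornerJet_transfer` reduces `Λ(J_S) = Λ(J_D)` for the corner limits
`J_S, J_D` of the third jet (`Λ(J) = ¼(J(N′,N′,N′) − J(A′,A′,N′))` for symmetric `J`, ★ `sum_sign_cube_signedRay_eq_wall02_of_symmetric`) to two facts along the punctured half-wall: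
(1) the boundary limits of the FIRST jets from the two sides agree on `N′` — §3, from the (J-nc) limit formula ★ `archLimitFormulaNoncompactWall_holds` (CM field): along the normal line
`h(s) = F_Θ(ζe^{i(tA′+sN′)}) = r(s)·g(s)` with `r(s) = i(2cos s − 2cos 3t)` EVEN, `r(0) ≠ 0` (semiregular wall point) and `g(s) = 2 sin s·Φ_Θ` the (J-nc) function whose derivative has ONE
two-sided limit `L` at `s = 0` (★ `rhoWeylDelta_angleChart_wall02_line`, ★ `angleChart_wall02_line_eq_curve`); the one-sided core §1 gives `h′(s) → r(0)·L` from EACH side (`h` has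
one-sided limits because `F` is Lipschitz on each chamber), and `h′(s) = D¹(F_Θ∘chart)(tA′+sN′)[N′]`; (2) the boundary limits of the THIRD jets agree on `(N′,N′,N′)` — from ★ `wall02_cubeLimit`
(road Z: the third `s`-derivative of `h` has ONE two-sided limit), since on each side it is `D³(F_Θ∘chart)(tA′+sN′)[N′,N′,N′]`.  HEAD **`chamberValue_Sminus_of_D`**: at a CM frame with
`re σ_wα₀·re σ_wα₂ < 0`, the (f1)-shaped jet data on `S⁻` and on `D = [1,0,2]` and the value `V` of every corner jet limit on `D` give the value `V` for every corner jet limit on `S⁻`.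
HONEST LABEL: HC_CM is proved only modulo the printed citations until rung 0 closes; bookkeeping over ★ files toward paying print row #179, pays nothing by itself.

## References
* [Rogawski1990] J. D. Rogawski, *Automorphic Representations of Unitary Groups in Three Variables*, Ann. of Math. Stud. 123 (1990), §8.4 pp. 126–127; §8.2 p. 119.
* [Varadarajan1989] V. S. Varadarajan, *An Introduction to Harmonic Analysis on Semisimple Lie Groups* (1989), §6.4 Thms 17, 22, 23 pp. 204–210.
* [WarnerHASSLG2] G. Warner, *Harmonic Analysis on Semi-Simple Lie Groups II* (1972), §8.5.1.
-/

set_option autoImplicit false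

noncomputable section

open Filter Topology Set Function Metric Complex MeasureTheory Measure NumberField NumberField.InfinitePlace Matrix
open scoped ContDiff NNReal Matrix MatrixGroups Matrix.Norms.Operator
open Literature.Analysis.Calculus
open Literature.NumberTheory.Automorphic Literature.NumberTheory.Automorphic.UnitaryGroup

/-! ## §1 Generic: the one-sided first-jet core `h = r·g`, `deriv g → L` two-sidedly, `h → α` one-sidedly ⟹ `deriv h → r(0)·L` one-sidedly -/

namespace Literature.Analysis.Calculus

/-- **ONE-SIDED CORE.**  `T ⊆ ℝ` (one side of `0`); `h = r·g` everywhere; `r` differentiable with `r′ → 0` at `0`, `r(0) ≠ 0`; `h` differentiable near `0` within `T` and `h → α` along `𝓝[T] 0`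
(a finite one-sided limit); `deriv g → L` along `𝓝[T] 0`.  Then `deriv h → r(0)·L` along `𝓝[T] 0`: on `T` near `0`, `g = h∕r`, `h′ = r′·(h∕r) + r·g′ → 0·(α∕r(0)) + r(0)·L`.
(Print: `g(ψ) = 2 sin ψ·Φ`, `lim ∂g∕∂ψ = c f^H(γ₀)`; the even cofactor of `ρ′Δ` kills the jump of `F` itself.) [cite: Rogawski1990, §8.2 p. 119] [cite: Varadarajan1989, §6.4 Thm 22] -/
theorem tendsto_deriv_of_eq_mul_of_tendsto {T : Set ℝ} {h r g : ℝ → ℂ} {r' : ℝ → ℂ}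
    (hr : ∀ s, HasDerivAt r (r' s) s) (hr'0 : Tendsto r' (𝓝 0) (𝓝 0)) (hr0 : r 0 ≠ 0)
    (heq : ∀ s, h s = r s * g s) (hh : ∀ᶠ s in 𝓝[T] 0, DifferentiableAt ℝ h s)
    {α : ℂ} (hα : Tendsto h (𝓝[T] 0) (𝓝 α)) {L : ℂ} (hg : Tendsto (fun s => deriv g s) (𝓝[T] 0) (𝓝 L)) :
    Tendsto (fun s => deriv h s) (𝓝[T] 0) (𝓝 (r 0 * L)) := by
  have hrc : Continuous r := continuous_iff_continuousAt.2 fun s => (hr s).continuousAt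
  have hV : IsOpen {s : ℝ | r s ≠ 0} := isOpen_ne_fun hrc continuous_const
  -- where `h` is differentiable and `r ≠ 0`: `deriv h = r′·(h∕r) + r·deriv g`
  have hformula : ∀ s, DifferentiableAt ℝ h s → r s ≠ 0 → deriv h s = r' s * (h s / r s) + r s * deriv g s := by
    intro s hsT hrs
    have hgloc : g =ᶠ[𝓝 s] fun x => h x / r x := by
      filter_upwards [hV.mem_nhds hrs] with x hx
      rw [heq x]
      field_simp
    have hgd : DifferentiableAt ℝ g s := by
      have hq : DifferentiableAt ℝ (fun x => h x / r x) s := hsT.div (hr s).differentiableAt hrs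
      exact hq.congr_of_eventuallyEq hgloc
    have hprod : HasDerivAt (fun x => r x * g x) (r' s * g s + r s * deriv g s) s := (hr s).mul hgd.hasDerivAt
    have hfun : h =ᶠ[𝓝 s] fun x => r x * g x := Filter.Eventually.of_forall heq
    rw [hfun.deriv_eq, hprod.deriv]
    congr 1
    rw [heq s, mul_div_cancel_left₀ _ hrs]
  -- the limit of the right-hand side
  have hev : ∀ᶠ s in 𝓝[T] 0, deriv h s = r' s * (h s / r s) + r s * deriv g s := by
    filter_upwards [hh, mem_nhdsWithin_of_mem_nhds (hV.mem_nhds hr0)] with s hsT hrs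
    exact hformula s hsT hrs
  have hr0t : Tendsto r (𝓝[T] 0) (𝓝 (r 0)) := (hrc.tendsto 0).mono_left nhdsWithin_le_nhds
  have hlim : Tendsto (fun s => r' s * (h s / r s) + r s * deriv g s) (𝓝[T] 0) (𝓝 (0 * (α / r 0) + r 0 * L)) :=
    ((hr'0.mono_left nhdsWithin_le_nhds).mul (hα.div hr0t hr0)).add (hr0t.mul hg)
  rw [zero_mul, zero_add] at hlim
  exact hlim.congr' (hev.mono fun s hs => hs.symm)

end Literature.Analysis.Calculus

namespace Literature.NumberTheory.Rogawski1990

/-! ## §2 Geometry of the pair `S⁻ = {θ₁<θ₂<θ₀}`, `D = {θ₁<θ₀<θ₂}` at the half-wall `tA′`, `t > 0`, inside the ball `B(0,r)` -/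

section Geometry

/-- Sup-norm of a point of `ℝ³` from its three coordinates. [cite: Rogawski1990, §8.4 p. 126] -/
theorem norm_lt_of_abs_apply_lt {θ : Fin 3 → ℝ} {r : ℝ} (hr : 0 < r) (h : ∀ i, |θ i| < r) : ‖θ‖ < r :=
  (pi_norm_lt_iff hr).2 fun i => by rw [Real.norm_eq_abs]; exact h i

/-- The wall ray `tA′` and the normal line `tA′ + sN′` stay in `B(0,r)` for `|t| < r∕4`, `|s| < r∕4`. [cite: Rogawski1990, §8.4 p. 126] -/
theorem wall02_line_mem_ball {r t s : ℝ} (hr : 0 < r) (ht : |t| < r / 4) (hs : |s| < r / 4) :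
    t • (![1, -2, 1] : Fin 3 → ℝ) + s • (![1, 0, -1] : Fin 3 → ℝ) ∈ ball (0 : Fin 3 → ℝ) r := by
  rw [mem_ball, dist_zero_right]
  obtain ⟨h0, h1, h2⟩ := wall02_line_apply t s
  refine norm_lt_of_abs_apply_lt hr fun i => ?_
  have ht' := abs_lt.1 ht
  have hs' := abs_lt.1 hs
  fin_cases i
  · show |(t • (![1, -2, 1] : Fin 3 → ℝ) + s • (![1, 0, -1] : Fin 3 → ℝ)) 0| < r
    rw [h0, abs_lt]; constructor <;> linarith
  · show |(t • (![1, -2, 1] : Fin 3 → ℝ) + s • (![1, 0, -1] : Fin 3 → ℝ)) 1| < r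
    rw [h1, abs_lt]; constructor <;> linarith
  · show |(t • (![1, -2, 1] : Fin 3 → ℝ) + s • (![1, 0, -1] : Fin 3 → ℝ)) 2| < r
    rw [h2, abs_lt]; constructor <;> linarith

/-- For `0 < t < r∕4`: eventually as `s → 0⁺` the normal-line point `tA′ + sN′` lies in `S⁻ ∩ B(0,r)`. [cite: Rogawski1990, §8.4 p. 126] -/
theorem eventually_wall02_line_mem_Sminus {r t : ℝ} (hr : 0 < r) (ht : 0 < t) (htr : t < r / 4) :
    ∀ᶠ s in 𝓝[>] (0 : ℝ), t • (![1, -2, 1] : Fin 3 → ℝ) + s • (![1, 0, -1] : Fin 3 → ℝ) ∈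
      {θ : Fin 3 → ℝ | θ 1 < θ 2 ∧ θ 2 < θ 0} ∩ ball (0 : Fin 3 → ℝ) r := by
  have hε : 0 < min (3 * t) (r / 4) := lt_min (by linarith) (by linarith)
  filter_upwards [Ioo_mem_nhdsGT hε] with s hs
  refine ⟨wall02_line_mem_chamber_pos_pos hs.1 (lt_of_lt_of_le hs.2 (min_le_left _ _)), wall02_line_mem_ball hr ?_ ?_⟩
  · rw [abs_of_pos ht]; exact htr
  · rw [abs_of_pos hs.1]; exact lt_of_lt_of_le hs.2 (min_le_right _ _)

/-- For `0 < t < r∕4`: eventually as `s → 0⁻` the normal-line point `tA′ + sN′` lies in `D ∩ B(0,r)`, `D = {θ₁<θ₀<θ₂}`. [cite: Rogawski1990, §8.4 p. 126] -/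
theorem eventually_wall02_line_mem_D {r t : ℝ} (hr : 0 < r) (ht : 0 < t) (htr : t < r / 4) :
    ∀ᶠ s in 𝓝[<] (0 : ℝ), t • (![1, -2, 1] : Fin 3 → ℝ) + s • (![1, 0, -1] : Fin 3 → ℝ) ∈
      {θ : Fin 3 → ℝ | θ 1 < θ 0 ∧ θ 0 < θ 2} ∩ ball (0 : Fin 3 → ℝ) r := by
  have hε : 0 < min (3 * t) (r / 4) := lt_min (by linarith) (by linarith)
  filter_upwards [Ioo_mem_nhdsLT (neg_lt_zero.2 hε)] with s hs
  have hs1 : -(3 * t) < s := lt_of_le_of_lt (neg_le_neg (min_le_left _ _)) hs.1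
  have hs2 : -(r / 4) < s := lt_of_le_of_lt (neg_le_neg (min_le_right _ _)) hs.1
  refine ⟨wall02_line_mem_chamber_pos_neg hs.2 hs1, wall02_line_mem_ball hr ?_ ?_⟩
  · rw [abs_of_pos ht]; exact htr
  · rw [abs_of_neg hs.2]; linarith

/-- The normal line tends to the wall point as `s → 0` (within any set it eventually stays in). [cite: Rogawski1990, §8.4 p. 126] -/
theorem tendsto_wall02_line_nhdsWithin {K : Set (Fin 3 → ℝ)} {l : Filter ℝ} (hl : l ≤ 𝓝 0) (t : ℝ)
    (hK : ∀ᶠ s in l, t • (![1, -2, 1] : Fin 3 → ℝ) + s • (![1, 0, -1] : Fin 3 → ℝ) ∈ K) :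
    Tendsto (fun s : ℝ => t • (![1, -2, 1] : Fin 3 → ℝ) + s • (![1, 0, -1] : Fin 3 → ℝ)) l (𝓝[K] (t • (![1, -2, 1] : Fin 3 → ℝ))) := by
  refine tendsto_nhdsWithin_iff.2 ⟨?_, hK⟩
  have hc : Continuous fun s : ℝ => t • (![1, -2, 1] : Fin 3 → ℝ) + s • (![1, 0, -1] : Fin 3 → ℝ) := by fun_prop
  have h := hc.tendsto 0
  simp only [zero_smul, add_zero] at h
  exact h.mono_left hl

/-- The wall point `tA′`, `0 < t < r∕4`, lies in the closure of `S⁻ ∩ B(0,r)` and of `D ∩ B(0,r)`. [cite: Rogawski1990, §8.4 p. 126] -/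
theorem wall02_point_mem_closure {r t : ℝ} (hr : 0 < r) (ht : 0 < t) (htr : t < r / 4) :
    t • (![1, -2, 1] : Fin 3 → ℝ) ∈ closure ({θ : Fin 3 → ℝ | θ 1 < θ 2 ∧ θ 2 < θ 0} ∩ ball (0 : Fin 3 → ℝ) r) ∧
      t • (![1, -2, 1] : Fin 3 → ℝ) ∈ closure ({θ : Fin 3 → ℝ | θ 1 < θ 0 ∧ θ 0 < θ 2} ∩ ball (0 : Fin 3 → ℝ) r) := by
  constructor
  · have h := tendsto_wall02_line_nhdsWithin (nhdsWithin_le_nhds (s := Ioi (0 : ℝ))) t (eventually_wall02_line_mem_Sminus hr ht htr)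
    exact mem_closure_of_tendsto ((tendsto_nhdsWithin_iff.1 h).1) ((tendsto_nhdsWithin_iff.1 h).2)
  · have h := tendsto_wall02_line_nhdsWithin (nhdsWithin_le_nhds (s := Iio (0 : ℝ))) t (eventually_wall02_line_mem_D hr ht htr)
    exact mem_closure_of_tendsto ((tendsto_nhdsWithin_iff.1 h).1) ((tendsto_nhdsWithin_iff.1 h).2)

/-- The corner lies in the closure of `C ∩ B(0,r)` for a chamber `C = {θ_a < θ_b < θ_c}` (approach along `s ↦ s•w`, `w = (−1,0,1)` permuted). [cite: Rogawski1990, §8.4 p. 126] -/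
theorem zero_mem_closure_chamber_inter_ball (a b c : Fin 3) (hab : a ≠ b) (hac : a ≠ c) (hbc : b ≠ c) {r : ℝ} (hr : 0 < r) :
    (0 : Fin 3 → ℝ) ∈ closure ({θ : Fin 3 → ℝ | θ a < θ b ∧ θ b < θ c} ∩ ball (0 : Fin 3 → ℝ) r) := by
  set w : Fin 3 → ℝ := fun i => if i = a then -1 else if i = b then 0 else 1 with hw
  have hwa : w a = -1 := by simp [hw]
  have hwb : w b = 0 := by simp [hw, hab.symm]
  have hwc : w c = 1 := by simp [hw, hac.symm, hbc.symm]
  have hwn : ‖w‖ ≤ 1 := by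
    refine (pi_norm_le_iff_of_nonneg zero_le_one).2 fun i => ?_
    simp only [hw, Real.norm_eq_abs]
    split_ifs <;> simp
  have hmem : ∀ s ∈ Ioo (0 : ℝ) r, s • w ∈ {θ : Fin 3 → ℝ | θ a < θ b ∧ θ b < θ c} ∩ ball (0 : Fin 3 → ℝ) r := by
    intro s hs
    refine ⟨?_, ?_⟩
    · simp only [mem_setOf_eq, Pi.smul_apply, smul_eq_mul, hwa, hwb, hwc]
      constructor <;> nlinarith [hs.1]
    · rw [mem_ball, dist_zero_right, norm_smul, Real.norm_eq_abs, abs_of_pos hs.1]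
      nlinarith [hs.1, hs.2, norm_nonneg w]
  have hc : Tendsto (fun s : ℝ => s • w) (𝓝[>] 0) (𝓝 0) := by
    have hc : Continuous fun s : ℝ => s • w := continuous_id.smul continuous_const
    simpa only [zero_smul] using (hc.tendsto 0).mono_left nhdsWithin_le_nhds
  exact mem_closure_of_tendsto hc (by filter_upwards [Ioo_mem_nhdsGT hr] with s hs using hmem s hs)

/-- Segments in the wall direction stay inside: for `y ∈ S⁻ ∩ B(0,r∕2)` (resp. `D ∩ B(0,r∕2)`) and `0 ≤ τ ≤ t < r∕4`, `y + τA′ ∈ S⁻ ∩ B(0,r)` (resp. `D ∩ B(0,r)`) — so eventually near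
the corner within the region. [cite: Rogawski1990, §8.4 p. 126] -/
theorem eventually_segment_wall02_mem {r t : ℝ} (hr : 0 < r) (htr : t < r / 4) (a b c : Fin 3)
    (hmono : ∀ (y : Fin 3 → ℝ) (τ : ℝ), 0 ≤ τ → y a < y b → y b < y c →
      (y + τ • (![1, -2, 1] : Fin 3 → ℝ)) a < (y + τ • (![1, -2, 1] : Fin 3 → ℝ)) b ∧ (y + τ • (![1, -2, 1] : Fin 3 → ℝ)) b < (y + τ • (![1, -2, 1] : Fin 3 → ℝ)) c) :
    ∀ᶠ y in 𝓝[{θ : Fin 3 → ℝ | θ a < θ b ∧ θ b < θ c} ∩ ball (0 : Fin 3 → ℝ) r] 0, ∀ τ ∈ Icc (0 : ℝ) t,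
      y + τ • (![1, -2, 1] : Fin 3 → ℝ) ∈ {θ : Fin 3 → ℝ | θ a < θ b ∧ θ b < θ c} ∩ ball (0 : Fin 3 → ℝ) r := by
  have hhalf : ball (0 : Fin 3 → ℝ) (r / 2) ∈ 𝓝 (0 : Fin 3 → ℝ) := Metric.ball_mem_nhds 0 (half_pos hr)
  filter_upwards [self_mem_nhdsWithin, mem_nhdsWithin_of_mem_nhds hhalf] with y hy hy2 τ hτ
  refine ⟨?_, ?_⟩
  · exact hmono y τ hτ.1 hy.1.1 hy.1.2
  · rw [mem_ball, dist_zero_right] at hy2 ⊢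
    have hA : ‖(![1, -2, 1] : Fin 3 → ℝ)‖ ≤ 2 := by
      refine (pi_norm_le_iff_of_nonneg (by norm_num)).2 fun i => ?_
      fin_cases i <;> simp
    calc ‖y + τ • (![1, -2, 1] : Fin 3 → ℝ)‖ ≤ ‖y‖ + ‖τ • (![1, -2, 1] : Fin 3 → ℝ)‖ := norm_add_le _ _
      _ = ‖y‖ + τ * ‖(![1, -2, 1] : Fin 3 → ℝ)‖ := by rw [norm_smul, Real.norm_eq_abs, abs_of_nonneg hτ.1]
      _ ≤ ‖y‖ + t * 2 := by
          have h2 : τ * ‖(![1, -2, 1] : Fin 3 → ℝ)‖ ≤ t * 2 := mul_le_mul hτ.2 hA (norm_nonneg _) (hτ.1.trans hτ.2)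
          linarith
      _ < r / 2 + r / 4 * 2 := by linarith
      _ = r := by ring

/-- The monotonicity facts for `S⁻ = [1,2,0]`: adding `τA′ = (τ, −2τ, τ)`, `τ ≥ 0`, keeps `θ₁ < θ₂ < θ₀`. [cite: Rogawski1990, §8.4 p. 126] -/
theorem segment_mono_Sminus (y : Fin 3 → ℝ) (τ : ℝ) (hτ : 0 ≤ τ) (h1 : y 1 < y 2) (h2 : y 2 < y 0) :
    (y + τ • (![1, -2, 1] : Fin 3 → ℝ)) 1 < (y + τ • (![1, -2, 1] : Fin 3 → ℝ)) 2 ∧ (y + τ • (![1, -2, 1] : Fin 3 → ℝ)) 2 < (y + τ • (![1, -2, 1] : Fin 3 → ℝ)) 0 := by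
  simp only [Pi.add_apply, Pi.smul_apply, smul_eq_mul, Matrix.cons_val_zero, Matrix.cons_val_one, Matrix.cons_val_two, Matrix.head_cons, Matrix.tail_cons]
  constructor <;> nlinarith

/-- The monotonicity facts for `D = [1,0,2]`: adding `τA′`, `τ ≥ 0`, keeps `θ₁ < θ₀ < θ₂`. [cite: Rogawski1990, §8.4 p. 126] -/
theorem segment_mono_D (y : Fin 3 → ℝ) (τ : ℝ) (hτ : 0 ≤ τ) (h1 : y 1 < y 0) (h2 : y 0 < y 2) :
    (y + τ • (![1, -2, 1] : Fin 3 → ℝ)) 1 < (y + τ • (![1, -2, 1] : Fin 3 → ℝ)) 0 ∧ (y + τ • (![1, -2, 1] : Fin 3 → ℝ)) 0 < (y + τ • (![1, -2, 1] : Fin 3 → ℝ)) 2 := by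
  simp only [Pi.add_apply, Pi.smul_apply, smul_eq_mul, Matrix.cons_val_zero, Matrix.cons_val_one, Matrix.cons_val_two, Matrix.head_cons, Matrix.tail_cons]
  constructor <;> nlinarith

/-- Diameter of a set inside `B(0,r)`. [cite: Rogawski1990, §8.4 p. 126] -/
theorem norm_sub_le_of_mem_inter_ball {S : Set (Fin 3 → ℝ)} {r : ℝ} (x : Fin 3 → ℝ) (hx : x ∈ S ∩ ball (0 : Fin 3 → ℝ) r) (y : Fin 3 → ℝ) (hy : y ∈ S ∩ ball (0 : Fin 3 → ℝ) r) :
    ‖y - x‖ ≤ 2 * r := by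
  have hx' : ‖x‖ < r := by simpa only [mem_ball, dist_zero_right] using hx.2
  have hy' : ‖y‖ < r := by simpa only [mem_ball, dist_zero_right] using hy.2
  calc ‖y - x‖ ≤ ‖y‖ + ‖x‖ := norm_sub_le _ _
    _ ≤ 2 * r := by linarith

end Geometry

/-! ## §3 The two wall hypotheses of `cornerJet_transfer` at the noncompact wall `θ₀ = θ₂`, in TRACE form (no corner extension) -/

section WallJets

/-- **(J3-odd)₁ IN TRACE FORM.**  `F` of class `C¹` on open `K₁, K₂`; at the wall point `tA′` (semiregular: `cos 3t ≠ 1`) the normal line `tA′ + sN′` enters `K₁` as `s → 0⁺` and `K₂` as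
`s → 0⁻`; `F` has one-sided limits `α₁, α₂` there (it is Lipschitz on each chamber); ALONG THE NORMAL LINE `F(tA′+sN′) = r(s)·g(s)` with the EVEN cofactor `r(s) = i(2cos s − 2cos 3t)` of
★ `rhoWeylDelta_angleChart_wall02_line` and `g` the (J-nc) function `2 sin s · Φ`, whose derivative has ONE two-sided limit at `s = 0` (★ `ArchLimitFormulaNoncompactWall`).  THEN any boundary
limits `P, Q` of `D¹F` at `tA′` from `K₁`, `K₂` agree on the normal: `P[N′] = Q[N′]` — both equal `r(0)·L` by §1 on each side.  Jet twin of ★ `deriv_cornerExtensions_eq_of_wall02_limitFormula`.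
[cite: Rogawski1990, §8.2 p. 119] [cite: Varadarajan1989, §6.4 Thm 22] -/
theorem wall02_firstJet_boundaryLimits_eq (F : (Fin 3 → ℝ) → ℂ) {K₁ K₂ : Set (Fin 3 → ℝ)} (hK₁ : IsOpen K₁) (hK₂ : IsOpen K₂)
    (hF₁ : ContDiffOn ℝ 1 F K₁) (hF₂ : ContDiffOn ℝ 1 F K₂) (t : ℝ) (ht : Real.cos (3 * t) ≠ 1)
    (g : ℝ → ℂ) (hg : ∀ s : ℝ, F (t • (![1, -2, 1] : Fin 3 → ℝ) + s • (![1, 0, -1] : Fin 3 → ℝ)) = (Complex.I * (2 * Real.cos s - 2 * Real.cos (3 * t) : ℂ)) * g s)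
    (hside₁ : ∀ᶠ s in 𝓝[>] (0 : ℝ), t • (![1, -2, 1] : Fin 3 → ℝ) + s • (![1, 0, -1] : Fin 3 → ℝ) ∈ K₁) (hside₂ : ∀ᶠ s in 𝓝[<] (0 : ℝ), t • (![1, -2, 1] : Fin 3 → ℝ) + s • (![1, 0, -1] : Fin 3 → ℝ) ∈ K₂)
    {α₁ α₂ : ℂ} (hα₁ : Tendsto F (𝓝[K₁] (t • (![1, -2, 1] : Fin 3 → ℝ))) (𝓝 α₁)) (hα₂ : Tendsto F (𝓝[K₂] (t • (![1, -2, 1] : Fin 3 → ℝ))) (𝓝 α₂))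
    (hJ : ∃ Lim : ℂ, Tendsto (fun ψ : ℝ => deriv g ψ) (𝓝[≠] 0) (𝓝 Lim))
    {P Q : ContinuousMultilinearMap ℝ (fun _ : Fin 1 => Fin 3 → ℝ) ℂ}
    (hP : Tendsto (iteratedFDeriv ℝ 1 F) (𝓝[K₁] (t • (![1, -2, 1] : Fin 3 → ℝ))) (𝓝 P)) (hQ : Tendsto (iteratedFDeriv ℝ 1 F) (𝓝[K₂] (t • (![1, -2, 1] : Fin 3 → ℝ))) (𝓝 Q)) :
    P ![(![1, 0, -1] : Fin 3 → ℝ)] = Q ![(![1, 0, -1] : Fin 3 → ℝ)] := by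
  obtain ⟨Lim, hLim⟩ := hJ
  set line : ℝ → (Fin 3 → ℝ) := fun s : ℝ => t • (![1, -2, 1] : Fin 3 → ℝ) + s • (![1, 0, -1] : Fin 3 → ℝ) with hlinedef
  set r : ℝ → ℂ := fun s : ℝ => Complex.I * (2 * Real.cos s - 2 * Real.cos (3 * t) : ℂ) with hrdef
  have hr : ∀ s : ℝ, HasDerivAt r (Complex.I * (2 * ((-Real.sin s : ℝ) : ℂ))) s := by
    intro s
    have h := (((Real.hasDerivAt_cos s).ofReal_comp).const_mul (2 : ℂ)).sub_const (2 * Real.cos (3 * t) : ℂ)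
    exact h.const_mul Complex.I
  have hr'0 : Tendsto (fun s : ℝ => Complex.I * (2 * ((-Real.sin s : ℝ) : ℂ))) (𝓝 0) (𝓝 0) := by
    have hc : Continuous fun s : ℝ => Complex.I * (2 * ((-Real.sin s : ℝ) : ℂ)) := by fun_prop
    simpa only [Real.sin_zero, neg_zero, Complex.ofReal_zero, mul_zero] using hc.tendsto 0
  have hr0 : r 0 ≠ 0 := by
    have hreal : (2 * Real.cos (0 : ℝ) - 2 * Real.cos (3 * t) : ℝ) ≠ 0 := by
      rw [Real.cos_zero]
      intro h
      exact ht (by linarith)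
    refine mul_ne_zero Complex.I_ne_zero ?_
    exact_mod_cast hreal
  have heq : ∀ s : ℝ, F (line s) = r s * g s := fun s => hg s
  have hline : ∀ s : ℝ, HasDerivAt line (![1, 0, -1] : Fin 3 → ℝ) s := fun s => by
    have h := ((hasDerivAt_id s).smul_const (![1, 0, -1] : Fin 3 → ℝ)).const_add (t • (![1, -2, 1] : Fin 3 → ℝ))
    simpa [hlinedef] using h
  have hderiv : ∀ ⦃K : Set (Fin 3 → ℝ)⦄, IsOpen K → ContDiffOn ℝ 1 F K → ∀ s : ℝ, line s ∈ K →
      DifferentiableAt ℝ (fun s : ℝ => F (line s)) s ∧ deriv (fun s : ℝ => F (line s)) s = iteratedFDeriv ℝ 1 F (line s) ![(![1, 0, -1] : Fin 3 → ℝ)] := by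
    intro K hK hFK s hs
    have hFd : DifferentiableAt ℝ F (line s) := (hFK.differentiableOn one_ne_zero _ hs).differentiableAt (hK.mem_nhds hs)
    have hc : HasDerivAt (fun s : ℝ => F (line s)) (fderiv ℝ F (line s) (![1, 0, -1] : Fin 3 → ℝ)) s := hFd.hasFDerivAt.comp_hasDerivAt s (hline s)
    refine ⟨hc.differentiableAt, ?_⟩
    rw [hc.deriv, iteratedFDeriv_one_apply]
    rfl
  -- ONE SIDE `T` (`= Ioi 0` or `Iio 0`): the limit of `deriv (F∘line)` along `𝓝[T] 0` is `r(0)·Lim` AND the boundary jet on `N′`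
  have key : ∀ ⦃K : Set (Fin 3 → ℝ)⦄ ⦃T : Set ℝ⦄, T ⊆ {s : ℝ | s ≠ 0} → (𝓝[T] (0 : ℝ)).NeBot → IsOpen K → ContDiffOn ℝ 1 F K → (∀ᶠ s in 𝓝[T] (0 : ℝ), line s ∈ K) →
      ∀ ⦃α : ℂ⦄, Tendsto F (𝓝[K] (t • (![1, -2, 1] : Fin 3 → ℝ))) (𝓝 α) →
      ∀ ⦃R : ContinuousMultilinearMap ℝ (fun _ : Fin 1 => Fin 3 → ℝ) ℂ⦄, Tendsto (iteratedFDeriv ℝ 1 F) (𝓝[K] (t • (![1, -2, 1] : Fin 3 → ℝ))) (𝓝 R) → R ![(![1, 0, -1] : Fin 3 → ℝ)] = r 0 * Lim := by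
    intro K T hT hne hK hFK hmem α hα R hR
    haveI := hne
    have hlineT : Tendsto line (𝓝[T] 0) (𝓝[K] (t • (![1, -2, 1] : Fin 3 → ℝ))) := tendsto_wall02_line_nhdsWithin nhdsWithin_le_nhds t hmem
    have hh : ∀ᶠ s in 𝓝[T] (0 : ℝ), DifferentiableAt ℝ (fun s : ℝ => F (line s)) s := hmem.mono fun s hs => (hderiv hK hFK s hs).1
    have hαT : Tendsto (fun s : ℝ => F (line s)) (𝓝[T] 0) (𝓝 α) := hα.comp hlineT
    have hgT : Tendsto (fun s : ℝ => deriv g s) (𝓝[T] 0) (𝓝 Lim) := hLim.mono_left (nhdsWithin_mono _ hT)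
    have h1 : Tendsto (fun s : ℝ => deriv (fun s : ℝ => F (line s)) s) (𝓝[T] 0) (𝓝 (r 0 * Lim)) :=
      Literature.Analysis.Calculus.tendsto_deriv_of_eq_mul_of_tendsto hr hr'0 hr0 heq hh hαT hgT
    have h2 : Tendsto (fun s : ℝ => deriv (fun s : ℝ => F (line s)) s) (𝓝[T] 0) (𝓝 (R ![(![1, 0, -1] : Fin 3 → ℝ)])) := by
      have h := ((ContinuousMultilinearMap.apply ℝ (fun _ : Fin 1 => Fin 3 → ℝ) ℂ ![(![1, 0, -1] : Fin 3 → ℝ)]).continuous.tendsto R).comp (hR.comp hlineT)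
      refine h.congr' ?_
      filter_upwards [hmem] with s hs
      exact ((hderiv hK hFK s hs).2).symm
    exact tendsto_nhds_unique h2 h1
  have hP' := key (fun s (hs : s ∈ Ioi (0 : ℝ)) => ne_of_gt hs) inferInstance hK₁ hF₁ hside₁ hα₁ hP
  have hQ' := key (fun s (hs : s ∈ Iio (0 : ℝ)) => ne_of_lt hs) inferInstance hK₂ hF₂ hside₂ hα₂ hQ
  rw [hP', hQ']

/-- **(J3-odd)₃ IN TRACE FORM.**  `F` of class `C³` on open `K₁, K₂`; the normal line through `tA′` enters `K₁` as `s → 0⁺` and `K₂` as `s → 0⁻`; the third `s`-derivative of `s ↦ F(tA′+sN′)` has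
ONE two-sided limit at `s = 0` (★ `wall02_cubeLimit`, road Z).  THEN any boundary limits `P, Q` of `D³F` at `tA′` from `K₁`, `K₂` agree on `(N′,N′,N′)` (on each side the `s`-derivative IS
`D³F(tA′+sN′)[N′,N′,N′]`, ★ `iteratedDeriv_line_eq_iteratedFDeriv_of_contDiffOn`).  Jet twin of ★ `iteratedDeriv_three_cornerExtensions_eq_of_wall02_cubeLimit`.
[cite: Rogawski1990, §8.4 p. 126] [cite: Varadarajan1989, §6.4 Thm 17] -/
theorem wall02_thirdJet_boundaryLimits_eq (F : (Fin 3 → ℝ) → ℂ) {K₁ K₂ : Set (Fin 3 → ℝ)} (hK₁ : IsOpen K₁) (hK₂ : IsOpen K₂)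
    (hF₁ : ContDiffOn ℝ 3 F K₁) (hF₂ : ContDiffOn ℝ 3 F K₂) (t : ℝ)
    (hside₁ : ∀ᶠ s in 𝓝[>] (0 : ℝ), t • (![1, -2, 1] : Fin 3 → ℝ) + s • (![1, 0, -1] : Fin 3 → ℝ) ∈ K₁) (hside₂ : ∀ᶠ s in 𝓝[<] (0 : ℝ), t • (![1, -2, 1] : Fin 3 → ℝ) + s • (![1, 0, -1] : Fin 3 → ℝ) ∈ K₂)
    (hcube : ∃ Lim : ℂ, Tendsto (fun ψ : ℝ => iteratedDeriv 3 (fun s : ℝ => F (t • (![1, -2, 1] : Fin 3 → ℝ) + s • (![1, 0, -1] : Fin 3 → ℝ))) ψ) (𝓝[≠] 0) (𝓝 Lim))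
    {P Q : ContinuousMultilinearMap ℝ (fun _ : Fin 3 => Fin 3 → ℝ) ℂ}
    (hP : Tendsto (iteratedFDeriv ℝ 3 F) (𝓝[K₁] (t • (![1, -2, 1] : Fin 3 → ℝ))) (𝓝 P)) (hQ : Tendsto (iteratedFDeriv ℝ 3 F) (𝓝[K₂] (t • (![1, -2, 1] : Fin 3 → ℝ))) (𝓝 Q)) :
    P ![(![1, 0, -1] : Fin 3 → ℝ), (![1, 0, -1] : Fin 3 → ℝ), (![1, 0, -1] : Fin 3 → ℝ)] = Q ![(![1, 0, -1] : Fin 3 → ℝ), (![1, 0, -1] : Fin 3 → ℝ), (![1, 0, -1] : Fin 3 → ℝ)] := by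
  obtain ⟨Lim, hLim⟩ := hcube
  have hfun : (fun s : ℝ => F (t • (![1, -2, 1] : Fin 3 → ℝ) + s • (![1, 0, -1] : Fin 3 → ℝ))) = fun s : ℝ => F (s • (![1, 0, -1] : Fin 3 → ℝ) + t • (![1, -2, 1] : Fin 3 → ℝ)) := by
    funext s; rw [add_comm]
  have hvec : (fun _ : Fin 3 => (![1, 0, -1] : Fin 3 → ℝ)) = ![(![1, 0, -1] : Fin 3 → ℝ), (![1, 0, -1] : Fin 3 → ℝ), (![1, 0, -1] : Fin 3 → ℝ)] := by
    funext i; fin_cases i <;> rfl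
  have key : ∀ ⦃K : Set (Fin 3 → ℝ)⦄ ⦃T : Set ℝ⦄, T ⊆ {s : ℝ | s ≠ 0} → (𝓝[T] (0 : ℝ)).NeBot → IsOpen K → ContDiffOn ℝ 3 F K → (∀ᶠ s in 𝓝[T] (0 : ℝ), t • (![1, -2, 1] : Fin 3 → ℝ) + s • (![1, 0, -1] : Fin 3 → ℝ) ∈ K) →
      ∀ ⦃R : ContinuousMultilinearMap ℝ (fun _ : Fin 3 => Fin 3 → ℝ) ℂ⦄, Tendsto (iteratedFDeriv ℝ 3 F) (𝓝[K] (t • (![1, -2, 1] : Fin 3 → ℝ))) (𝓝 R) → R ![(![1, 0, -1] : Fin 3 → ℝ), (![1, 0, -1] : Fin 3 → ℝ), (![1, 0, -1] : Fin 3 → ℝ)] = Lim := by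
    intro K T hT hne hK hFK hmem R hR
    haveI := hne
    have hlineT : Tendsto (fun s : ℝ => t • (![1, -2, 1] : Fin 3 → ℝ) + s • (![1, 0, -1] : Fin 3 → ℝ)) (𝓝[T] 0) (𝓝[K] (t • (![1, -2, 1] : Fin 3 → ℝ))) := tendsto_wall02_line_nhdsWithin nhdsWithin_le_nhds t hmem
    have h1 : Tendsto (fun ψ : ℝ => iteratedDeriv 3 (fun s : ℝ => F (t • (![1, -2, 1] : Fin 3 → ℝ) + s • (![1, 0, -1] : Fin 3 → ℝ))) ψ) (𝓝[T] 0) (𝓝 Lim) := hLim.mono_left (nhdsWithin_mono _ hT)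
    have h2 : Tendsto (fun ψ : ℝ => iteratedDeriv 3 (fun s : ℝ => F (t • (![1, -2, 1] : Fin 3 → ℝ) + s • (![1, 0, -1] : Fin 3 → ℝ))) ψ) (𝓝[T] 0) (𝓝 (R ![(![1, 0, -1] : Fin 3 → ℝ), (![1, 0, -1] : Fin 3 → ℝ), (![1, 0, -1] : Fin 3 → ℝ)])) := by
      have h := ((ContinuousMultilinearMap.apply ℝ (fun _ : Fin 3 => Fin 3 → ℝ) ℂ ![(![1, 0, -1] : Fin 3 → ℝ), (![1, 0, -1] : Fin 3 → ℝ), (![1, 0, -1] : Fin 3 → ℝ)]).continuous.tendsto R).comp (hR.comp hlineT)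
      refine h.congr' ?_
      filter_upwards [hmem] with s hs
      rw [hfun]
      have hs' : s • (![1, 0, -1] : Fin 3 → ℝ) + t • (![1, -2, 1] : Fin 3 → ℝ) ∈ K := by rwa [add_comm]
      have e := iteratedDeriv_line_eq_iteratedFDeriv_of_contDiffOn hK hFK (![1, 0, -1] : Fin 3 → ℝ) (t • (![1, -2, 1] : Fin 3 → ℝ)) (t := s) hs' (k := 3) le_rfl
      rw [e, hvec]
      simp only [Function.comp_apply, ContinuousMultilinearMap.apply_apply]
      rw [add_comm]
    exact tendsto_nhds_unique h2 h1
  rw [key (fun s (hs : s ∈ Ioi (0 : ℝ)) => ne_of_gt hs) inferInstance hK₁ hF₁ hside₁ hP,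
    key (fun s (hs : s ∈ Iio (0 : ℝ)) => ne_of_lt hs) inferInstance hK₂ hF₂ hside₂ hQ]

end WallJets

/-! ## §4 The symmetry of corner jet limits and the value on `S⁻` -/

section Sminus

/-- A corner (or boundary) limit of the third jet of a `C³` function from inside an open set is a SYMMETRIC trilinear map (symmetry of `D³F` on the open set, ★ `iteratedFDeriv_comp_perm_of_le`,
passes to the limit). [cite: Rogawski1990, §8.4 p. 126] -/
theorem symmetric_of_tendsto_iteratedFDeriv_three {F : (Fin 3 → ℝ) → ℂ} {K : Set (Fin 3 → ℝ)} (hK : IsOpen K) (hF : ContDiffOn ℝ 3 F K) {x : Fin 3 → ℝ} (hx : x ∈ closure K)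
    {J : ContinuousMultilinearMap ℝ (fun _ : Fin 3 => Fin 3 → ℝ) ℂ} (hJ : Tendsto (iteratedFDeriv ℝ 3 F) (𝓝[K] x) (𝓝 J)) :
    ∀ (v : Fin 3 → (Fin 3 → ℝ)) (σ : Equiv.Perm (Fin 3)), J (v ∘ σ) = J v := by
  intro v σ
  haveI : (𝓝[K] x).NeBot := mem_closure_iff_nhdsWithin_neBot.1 hx
  have h1 : Tendsto (fun y => iteratedFDeriv ℝ 3 F y (v ∘ σ)) (𝓝[K] x) (𝓝 (J (v ∘ σ))) :=
    ((ContinuousMultilinearMap.apply ℝ (fun _ : Fin 3 => Fin 3 → ℝ) ℂ (v ∘ σ)).continuous.tendsto J).comp hJ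
  have h2 : Tendsto (fun y => iteratedFDeriv ℝ 3 F y v) (𝓝[K] x) (𝓝 (J v)) :=
    ((ContinuousMultilinearMap.apply ℝ (fun _ : Fin 3 => Fin 3 → ℝ) ℂ v).continuous.tendsto J).comp hJ
  have heq : (fun y => iteratedFDeriv ℝ 3 F y (v ∘ σ)) =ᶠ[𝓝[K] x] fun y => iteratedFDeriv ℝ 3 F y v := by
    filter_upwards [self_mem_nhdsWithin] with y hy
    exact iteratedFDeriv_comp_perm_of_le (hF.contDiffAt (hK.mem_nhds hy)) le_rfl v σ
  exact tendsto_nhds_unique_of_eventuallyEq h1 h2 heq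

/-- Order-zero boundary limit from the `0`-jet limit: `Dᵏ` with `k = 0` is the function itself. [cite: WarnerHASSLG2, §8.5.1] -/
theorem tendsto_of_tendsto_iteratedFDeriv_zero {F : (Fin 3 → ℝ) → ℂ} {l : Filter (Fin 3 → ℝ)} {R : ContinuousMultilinearMap ℝ (fun _ : Fin 0 => Fin 3 → ℝ) ℂ}
    (h : Tendsto (iteratedFDeriv ℝ 0 F) l (𝓝 R)) : Tendsto F l (𝓝 (R (fun _ => 0))) := by
  have h' := ((ContinuousMultilinearMap.apply ℝ (fun _ : Fin 0 => Fin 3 → ℝ) ℂ (fun _ => 0)).continuous.tendsto R).comp h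
  refine h'.congr fun y => ?_
  simp only [Function.comp_apply, ContinuousMultilinearMap.apply_apply, iteratedFDeriv_zero_apply]

variable (L : Type) [Field L] [NumberField L] [IsCMField L] (α : Fin 3 → L) (w : {w : InfinitePlace L // IsComplex w})

/-- **THE VALUE ON `S⁻ = {θ₁<θ₂<θ₀}` FROM THE VALUE ON `D = {θ₁<θ₀<θ₂}`** (jet form of the corner transfer ★ (h4) + (J3-odd)₁∕₃, CM ground field, frame with `re σ_wα₀·re σ_wα₂ < 0`).
Inputs: the (d2)+(f1)-shaped fourth-jet data of `F_Θ∘chart_ζ` on `S⁻ ∩ B(0,r_S)` and on `D ∩ B(0,r_D)` (★ `letterJetBound_of_liePhiJetBounds`), and the value `V` of EVERY corner limit of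
the third jet within `D` (★ FILE 2 `chamberValue_max_of_min`: `D` is θ₂-maximal).  Output: every corner limit `J` of the third jet within `S⁻` has the letter value `(1∕48) Σ_ε ε₀ε₁ε₂·J[v_ε³] = V`.
Route: FILE 3a `cornerJet_transfer` on `(S⁻ ∩ B, D ∩ B)` along the half-wall `tA′`, `0 < t < r∕4`, fed by §3 ((J-nc) ★ `archLimitFormulaNoncompactWall_holds` with ★ centraliser Haar measure;
★ `wall02_cubeLimit`) ⇒ `J[N′³] = J_D[N′³]`, `J[A′,A′,N′] = J_D[A′,A′,N′]`; symmetry of `J, J_D`; ★ `sum_sign_cube_signedRay_eq_wall02_of_symmetric` (`Σ_ε = 12(J(N′³) − J(A′,A′,N′))`).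
[cite: Rogawski1990, §8.4 pp. 126–127] [cite: Rogawski1990, §8.2 p. 119] [cite: Varadarajan1989, §6.4 Thms 17, 22] -/
theorem chamberValue_Sminus_of_D
    [MeasurableSpace (archLocal L 3 (Matrix.diagonal α) w)] [BorelSpace (archLocal L 3 (Matrix.diagonal α) w)]
    (hα : ∀ i, α i ≠ 0) (hreal : ∀ i, (w.1.embedding (α i)).im = 0) (hsgn : (w.1.embedding (α 0)).re * (w.1.embedding (α 2)).re < 0)
    (ν : Measure (archLocal L 3 (Matrix.diagonal α) w)) [ν.IsHaarMeasure] [ν.IsMulRightInvariant]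
    (Θ : Matrix (Fin 3) (Fin 3) ℂ → ℂ) (hΘ : ContDiff ℝ ∞ Θ)
    (hΘc : HasCompactSupport fun k : archLocal L 3 (Matrix.diagonal α) w => Θ ((k : GL (Fin 3) ℂ) : Matrix (Fin 3) (Fin 3) ℂ))
    (ζ : Circle)
    {rS : ℝ} {MS : ℝ≥0} (hrS : 0 < rS) (hFS : ContDiffOn ℝ 4 (fun θ : Fin 3 → ℝ => ((((ζ * Circle.exp (θ 0) : Circle) : ℂ)) * (((ζ * Circle.exp (θ 2) : Circle) : ℂ))⁻¹) * ((1 - (((ζ * Circle.exp (θ 1) : Circle) : ℂ)) * (((ζ * Circle.exp (θ 0) : Circle) : ℂ))⁻¹) * (1 - (((ζ * Circle.exp (θ 2) : Circle) : ℂ)) * (((ζ * Circle.exp (θ 1) : Circle) : ℂ))⁻¹) * (1 - (((ζ * Circle.exp (θ 2) : Circle) : ℂ)) * (((ζ * Circle.exp (θ 0) : Circle) : ℂ))⁻¹)) * (∫ g, Θ (((g * ⟨circleDiagonal 3 (fun k => ζ * Circle.exp (θ k)), circleDiagonal_mem_archLocal_diagonal L 3 α w _⟩ * g⁻¹ : archLocal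 L 3 (Matrix.diagonal α) w) : GL (Fin 3) ℂ) : Matrix (Fin 3) (Fin 3) ℂ) ∂ν)) ({θ : Fin 3 → ℝ | θ 1 < θ 2 ∧ θ 2 < θ 0} ∩ ball 0 rS))
    (hMS : ∀ θ ∈ {θ : Fin 3 → ℝ | θ 1 < θ 2 ∧ θ 2 < θ 0} ∩ ball 0 rS, ‖iteratedFDeriv ℝ 4 (fun θ : Fin 3 → ℝ => ((((ζ * Circle.exp (θ 0) : Circle) : ℂ)) * (((ζ * Circle.exp (θ 2) : Circle) : ℂ))⁻¹) * ((1 - (((ζ * Circle.exp (θ 1) : Circle) : ℂ)) * (((ζ * Circle.exp (θ 0) : Circle) : ℂ))⁻¹) * (1 - (((ζ * Circle.exp (θ 2) : Circle) : ℂ)) * (((ζ * Circle.exp (θ 1) : Circle) : ℂ))⁻¹) * (1 - (((ζ * Circle.exp (θ 2) : Circle) : ℂ)) * (((ζ * Circle.exp (θ 0) : Circle) : ℂ))⁻¹)) * (∫ g, Θ (((g * ⟨circleDiagonal 3 (fun k => ζ * Circle.exp (θ k)), circleDiagonal_mem_archLocal_diagonal L 3 α w _⟩ * g⁻¹ : archLocal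 L 3 (Matrix.diagonal α) w) : GL (Fin 3) ℂ) : Matrix (Fin 3) (Fin 3) ℂ) ∂ν)) θ‖₊ ≤ MS)
    {rD : ℝ} {MD : ℝ≥0} (hrD : 0 < rD) (hFD : ContDiffOn ℝ 4 (fun θ : Fin 3 → ℝ => ((((ζ * Circle.exp (θ 0) : Circle) : ℂ)) * (((ζ * Circle.exp (θ 2) : Circle) : ℂ))⁻¹) * ((1 - (((ζ * Circle.exp (θ 1) : Circle) : ℂ)) * (((ζ * Circle.exp (θ 0) : Circle) : ℂ))⁻¹) * (1 - (((ζ * Circle.exp (θ 2) : Circle) : ℂ)) * (((ζ * Circle.exp (θ 1) : Circle) : ℂ))⁻¹) * (1 - (((ζ * Circle.exp (θ 2) : Circle) : ℂ)) * (((ζ * Circle.exp (θ 0) : Circle) : ℂ))⁻¹)) * (∫ g, Θ (((g * ⟨circleDiagonal 3 (fun k => ζ * Circle.exp (θ k)), circleDiagonal_mem_archLocal_diagonal L 3 α w _⟩ * g⁻¹ : archLocal L 3 (Matrix.diagonal α) w) : GL (Fin 3) ℂ) : Matrix (Fin 3) (Fin 3) ℂ) ∂ν)) ({θ : Fin 3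 → ℝ | θ 1 < θ 0 ∧ θ 0 < θ 2} ∩ ball 0 rD))
    (hMD : ∀ θ ∈ {θ : Fin 3 → ℝ | θ 1 < θ 0 ∧ θ 0 < θ 2} ∩ ball 0 rD, ‖iteratedFDeriv ℝ 4 (fun θ : Fin 3 → ℝ => ((((ζ * Circle.exp (θ 0) : Circle) : ℂ)) * (((ζ * Circle.exp (θ 2) : Circle) : ℂ))⁻¹) * ((1 - (((ζ * Circle.exp (θ 1) : Circle) : ℂ)) * (((ζ * Circle.exp (θ 0) : Circle) : ℂ))⁻¹) * (1 - (((ζ * Circle.exp (θ 2) : Circle) : ℂ)) * (((ζ * Circle.exp (θ 1) : Circle) : ℂ))⁻¹) * (1 - (((ζ * Circle.exp (θ 2) : Circle) : ℂ)) * (((ζ * Circle.exp (θ 0) : Circle) : ℂ))⁻¹)) * (∫ g, Θ (((g * ⟨circleDiagonal 3 (fun k => ζ * Circle.exp (θ k)), circleDiagonal_mem_archLocal_diagonal L 3 α w _⟩ * g⁻¹ : archLocal L 3 (Matrix.diagonal α) w) : GL (Fin 3) ℂ) : Matrix (Fin 3) (Fin 3) ℂ) ∂ν)) θ‖₊ ≤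 MD)
    {V : ℂ} (hD : ∀ J : ContinuousMultilinearMap ℝ (fun _ : Fin 3 => Fin 3 → ℝ) ℂ,
      Tendsto (iteratedFDeriv ℝ 3 (fun θ : Fin 3 → ℝ => ((((ζ * Circle.exp (θ 0) : Circle) : ℂ)) * (((ζ * Circle.exp (θ 2) : Circle) : ℂ))⁻¹) * ((1 - (((ζ * Circle.exp (θ 1) : Circle) : ℂ)) * (((ζ * Circle.exp (θ 0) : Circle) : ℂ))⁻¹) * (1 - (((ζ * Circle.exp (θ 2) : Circle) : ℂ)) * (((ζ * Circle.exp (θ 1) : Circle) : ℂ))⁻¹) * (1 - (((ζ * Circle.exp (θ 2) : Circle) : ℂ)) * (((ζ * Circle.exp (θ 0) : Circle) : ℂ))⁻¹)) * (∫ g, Θ (((g * ⟨circleDiagonal 3 (fun k => ζ * Circle.exp (θ k)), circleDiagonal_mem_archLocal_diagonal L 3 α w _⟩ * g⁻¹ : archLocal L 3 (Matrix.diagonal α) w) : GL (Fin 3) ℂ) : Matrix (Fin 3) (Fin 3) ℂ) ∂ν))) (𝓝[{θ : Fin 3 → ℝ | θ 1 < θ 0 ∧ θ 0 < θ 2}]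 0) (𝓝 J) →
        (1 / 48 : ℂ) * ∑ ε : Fin 3 → Bool, ((((if ε 0 then (1 : ℝ) else -1) * (if ε 1 then (1 : ℝ) else -1) * (if ε 2 then (1 : ℝ) else -1) : ℝ)) : ℂ) * J (fun _ : Fin 3 => ![(if ε 0 then (1 : ℝ) else -1) + (if ε 1 then (1 : ℝ) else -1), -(if ε 0 then (1 : ℝ) else -1) + (if ε 2 then (1 : ℝ) else -1), -(if ε 1 then (1 : ℝ) else -1) - (if ε 2 then (1 : ℝ) else -1)]) = V)
    (J : ContinuousMultilinearMap ℝ (fun _ : Fin 3 => Fin 3 → ℝ) ℂ)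
    (hJ : Tendsto (iteratedFDeriv ℝ 3 (fun θ : Fin 3 → ℝ => ((((ζ * Circle.exp (θ 0) : Circle) : ℂ)) * (((ζ * Circle.exp (θ 2) : Circle) : ℂ))⁻¹) * ((1 - (((ζ * Circle.exp (θ 1) : Circle) : ℂ)) * (((ζ * Circle.exp (θ 0) : Circle) : ℂ))⁻¹) * (1 - (((ζ * Circle.exp (θ 2) : Circle) : ℂ)) * (((ζ * Circle.exp (θ 1) : Circle) : ℂ))⁻¹) * (1 - (((ζ * Circle.exp (θ 2) : Circle) : ℂ)) * (((ζ * Circle.exp (θ 0) : Circle) : ℂ))⁻¹)) * (∫ g, Θ (((g * ⟨circleDiagonal 3 (fun k => ζ * Circle.exp (θ k)), circleDiagonal_mem_archLocal_diagonal L 3 α w _⟩ * g⁻¹ : archLocal L 3 (Matrix.diagonal α) w) : GL (Fin 3) ℂ) : Matrix (Fin 3) (Fin 3) ℂ) ∂ν))) (𝓝[{θ : Fin 3 → ℝ | θ 1 < θ 2 ∧ θ 2 < θ 0}] 0) (𝓝 J)) :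
    (1 / 48 : ℂ) * ∑ ε : Fin 3 → Bool, ((((if ε 0 then (1 : ℝ) else -1) * (if ε 1 then (1 : ℝ) else -1) * (if ε 2 then (1 : ℝ) else -1) : ℝ)) : ℂ) * J (fun _ : Fin 3 => ![(if ε 0 then (1 : ℝ) else -1) + (if ε 1 then (1 : ℝ) else -1), -(if ε 0 then (1 : ℝ) else -1) + (if ε 2 then (1 : ℝ) else -1), -(if ε 1 then (1 : ℝ) else -1) - (if ε 2 then (1 : ℝ) else -1)]) = V := by
  haveI : LocallyCompactSpace (archLocal L 3 (Matrix.diagonal α) w) := locallyCompactSpace_archLocal L 3 (Matrix.diagonal α) w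
  haveI : SecondCountableTopology (archLocal L 3 (Matrix.diagonal α) w) := secondCountableTopology_archLocal L 3 (Matrix.diagonal α) w
  -- common radius `r ≤ 1` and bound `M`
  set r : ℝ := min (min rS rD) 1 with hrdef
  have hr : 0 < r := lt_min (lt_min hrS hrD) one_pos
  have hrS' : r ≤ rS := (min_le_left _ _).trans (min_le_left _ _)
  have hrD' : r ≤ rD := (min_le_left _ _).trans (min_le_right _ _)
  have hr1 : r ≤ 1 := min_le_right _ _
  set M : ℝ := max (MS : ℝ) (MD : ℝ) with hMdef
  have hKS_sub : {θ : Fin 3 → ℝ | θ 1 < θ 2 ∧ θ 2 < θ 0} ∩ ball (0 : Fin 3 → ℝ) r ⊆ {θ : Fin 3 → ℝ | θ 1 < θ 2 ∧ θ 2 < θ 0} ∩ ball 0 rS := inter_subset_inter_right _ (ball_subset_ball hrS')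
  have hKD_sub : {θ : Fin 3 → ℝ | θ 1 < θ 0 ∧ θ 0 < θ 2} ∩ ball (0 : Fin 3 → ℝ) r ⊆ {θ : Fin 3 → ℝ | θ 1 < θ 0 ∧ θ 0 < θ 2} ∩ ball 0 rD := inter_subset_inter_right _ (ball_subset_ball hrD')
  have hKSo : IsOpen ({θ : Fin 3 → ℝ | θ 1 < θ 2 ∧ θ 2 < θ 0} ∩ ball (0 : Fin 3 → ℝ) r) :=
    ((isOpen_lt (continuous_apply 1) (continuous_apply 2)).inter (isOpen_lt (continuous_apply 2) (continuous_apply 0))).inter isOpen_ball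
  have hKDo : IsOpen ({θ : Fin 3 → ℝ | θ 1 < θ 0 ∧ θ 0 < θ 2} ∩ ball (0 : Fin 3 → ℝ) r) :=
    ((isOpen_lt (continuous_apply 1) (continuous_apply 0)).inter (isOpen_lt (continuous_apply 0) (continuous_apply 2))).inter isOpen_ball
  have hKSc : Convex ℝ ({θ : Fin 3 → ℝ | θ 1 < θ 2 ∧ θ 2 < θ 0} ∩ ball (0 : Fin 3 → ℝ) r) :=
    ((convex_setOf_apply_lt_apply 1 2).inter (convex_setOf_apply_lt_apply 2 0)).inter (convex_ball 0 r)
  have hKDc : Convex ℝ ({θ : Fin 3 → ℝ | θ 1 < θ 0 ∧ θ 0 < θ 2} ∩ ball (0 : Fin 3 → ℝ) r) :=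
    ((convex_setOf_apply_lt_apply 1 0).inter (convex_setOf_apply_lt_apply 0 2)).inter (convex_ball 0 r)
  have hFS' : ContDiffOn ℝ 4 (fun θ : Fin 3 → ℝ => ((((ζ * Circle.exp (θ 0) : Circle) : ℂ)) * (((ζ * Circle.exp (θ 2) : Circle) : ℂ))⁻¹) * ((1 - (((ζ * Circle.exp (θ 1) : Circle) : ℂ)) * (((ζ * Circle.exp (θ 0) : Circle) : ℂ))⁻¹) * (1 - (((ζ * Circle.exp (θ 2) : Circle) : ℂ)) * (((ζ * Circle.exp (θ 1) : Circle) : ℂ))⁻¹) * (1 - (((ζ * Circle.exp (θ 2) : Circle) : ℂ)) * (((ζ * Circle.exp (θ 0) : Circle) : ℂ))⁻¹)) * (∫ g, Θ (((g * ⟨circleDiagonal 3 (fun k => ζ * Circle.exp (θ k)), circleDiagonal_mem_archLocal_diagonal L 3 α w _⟩ * g⁻¹ : archLocal L 3 (Matrix.diagonal α) w) : GL (Fin 3) ℂ) : Matrix (Fin 3) (Fin 3) ℂ) ∂ν)) ({θ : Fin 3 → ℝ | θ 1 < θ 2 ∧ θ 2 < θ 0} ∩ ball (0 : Fin 3 →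 ℝ) r) := hFS.mono hKS_sub
  have hFD' : ContDiffOn ℝ 4 (fun θ : Fin 3 → ℝ => ((((ζ * Circle.exp (θ 0) : Circle) : ℂ)) * (((ζ * Circle.exp (θ 2) : Circle) : ℂ))⁻¹) * ((1 - (((ζ * Circle.exp (θ 1) : Circle) : ℂ)) * (((ζ * Circle.exp (θ 0) : Circle) : ℂ))⁻¹) * (1 - (((ζ * Circle.exp (θ 2) : Circle) : ℂ)) * (((ζ * Circle.exp (θ 1) : Circle) : ℂ))⁻¹) * (1 - (((ζ * Circle.exp (θ 2) : Circle) : ℂ)) * (((ζ * Circle.exp (θ 0) : Circle) : ℂ))⁻¹)) * (∫ g, Θ (((g * ⟨circleDiagonal 3 (fun k => ζ * Circle.exp (θ k)), circleDiagonal_mem_archLocal_diagonal L 3 α w _⟩ * g⁻¹ : archLocal L 3 (Matrix.diagonal α) w) : GL (Fin 3) ℂ) : Matrix (Fin 3) (Fin 3) ℂ) ∂ν)) ({θ : Fin 3 → ℝ | θ 1 < θ 0 ∧ θ 0 < θ 2} ∩ ball (0 : Fin 3 → ℝ) r) := hFD.mono hKD_sub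
  have hMS' : ∀ θ ∈ ({θ : Fin 3 → ℝ | θ 1 < θ 2 ∧ θ 2 < θ 0} ∩ ball (0 : Fin 3 → ℝ) r), ‖iteratedFDeriv ℝ 4 (fun θ : Fin 3 → ℝ => ((((ζ * Circle.exp (θ 0) : Circle) : ℂ)) * (((ζ * Circle.exp (θ 2) : Circle) : ℂ))⁻¹) * ((1 - (((ζ * Circle.exp (θ 1) : Circle) : ℂ)) * (((ζ * Circle.exp (θ 0) : Circle) : ℂ))⁻¹) * (1 - (((ζ * Circle.exp (θ 2) : Circle) : ℂ)) * (((ζ * Circle.exp (θ 1) : Circle) : ℂ))⁻¹) * (1 - (((ζ * Circle.exp (θ 2) : Circle) : ℂ)) * (((ζ * Circle.exp (θ 0) : Circle) : ℂ))⁻¹)) * (∫ g, Θ (((g * ⟨circleDiagonal 3 (fun k => ζ * Circle.exp (θ k)), circleDiagonal_mem_archLocal_diagonal L 3 α w _⟩ * g⁻¹ : archLocal L 3 (Matrix.diagonal α) w) : GL (Fin 3) ℂ) : Matrix (Fin 3) (Fin 3) ℂ) ∂ν)) θ‖ ≤ M := by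
    intro θ hθ
    have h := hMS θ (hKS_sub hθ)
    rw [← NNReal.coe_le_coe, coe_nnnorm] at h
    exact h.trans (le_max_left _ _)
  have hMD' : ∀ θ ∈ ({θ : Fin 3 → ℝ | θ 1 < θ 0 ∧ θ 0 < θ 2} ∩ ball (0 : Fin 3 → ℝ) r), ‖iteratedFDeriv ℝ 4 (fun θ : Fin 3 → ℝ => ((((ζ * Circle.exp (θ 0) : Circle) : ℂ)) * (((ζ * Circle.exp (θ 2) : Circle) : ℂ))⁻¹) * ((1 - (((ζ * Circle.exp (θ 1) : Circle) : ℂ)) * (((ζ * Circle.exp (θ 0) : Circle) : ℂ))⁻¹) * (1 - (((ζ * Circle.exp (θ 2) : Circle) : ℂ)) * (((ζ * Circle.exp (θ 1) : Circle) : ℂ))⁻¹) * (1 - (((ζ * Circle.exp (θ 2) : Circle) : ℂ)) * (((ζ * Circle.exp (θ 0) : Circle) : ℂ))⁻¹)) * (∫ g, Θ (((g * ⟨circleDiagonal 3 (fun k => ζ * Circle.exp (θ k)), circleDiagonal_mem_archLocal_diagonal L 3 α w _⟩ * g⁻¹ : archLocal L 3 (Matrix.diagonal α) w) : GL (Fin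 3) ℂ) : Matrix (Fin 3) (Fin 3) ℂ) ∂ν)) θ‖ ≤ M := by
    intro θ hθ
    have h := hMD θ (hKD_sub hθ)
    rw [← NNReal.coe_le_coe, coe_nnnorm] at h
    exact h.trans (le_max_right _ _)
  have h0S : (0 : Fin 3 → ℝ) ∈ closure ({θ : Fin 3 → ℝ | θ 1 < θ 2 ∧ θ 2 < θ 0} ∩ ball (0 : Fin 3 → ℝ) r) := zero_mem_closure_chamber_inter_ball 1 2 0 (by decide) (by decide) (by decide) hr
  have h0D : (0 : Fin 3 → ℝ) ∈ closure ({θ : Fin 3 → ℝ | θ 1 < θ 0 ∧ θ 0 < θ 2} ∩ ball (0 : Fin 3 → ℝ) r) := zero_mem_closure_chamber_inter_ball 1 0 2 (by decide) (by decide) (by decide) hr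
  -- boundary limits of every order `k ≤ 3` exist at every point of the closures (FILE 3a)
  have hbS := exists_bound_iteratedFDeriv_of_le (n := 4) hKSo hKSc (fun x hx y hy => norm_sub_le_of_mem_inter_ball x hx y hy) hFS' hMS'
  have hbD := exists_bound_iteratedFDeriv_of_le (n := 4) hKDo hKDc (fun x hx y hy => norm_sub_le_of_mem_inter_ball x hx y hy) hFD' hMD'
  have hlimS : ∀ k : ℕ, k < 4 → ∀ x ∈ closure ({θ : Fin 3 → ℝ | θ 1 < θ 2 ∧ θ 2 < θ 0} ∩ ball (0 : Fin 3 → ℝ) r), ∃ R : ContinuousMultilinearMap ℝ (fun _ : Fin k => Fin 3 → ℝ) ℂ,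
      Tendsto (iteratedFDeriv ℝ k (fun θ : Fin 3 → ℝ => ((((ζ * Circle.exp (θ 0) : Circle) : ℂ)) * (((ζ * Circle.exp (θ 2) : Circle) : ℂ))⁻¹) * ((1 - (((ζ * Circle.exp (θ 1) : Circle) : ℂ)) * (((ζ * Circle.exp (θ 0) : Circle) : ℂ))⁻¹) * (1 - (((ζ * Circle.exp (θ 2) : Circle) : ℂ)) * (((ζ * Circle.exp (θ 1) : Circle) : ℂ))⁻¹) * (1 - (((ζ * Circle.exp (θ 2) : Circle) : ℂ)) * (((ζ * Circle.exp (θ 0) : Circle) : ℂ))⁻¹)) * (∫ g, Θ (((g * ⟨circleDiagonal 3 (fun k => ζ * Circle.exp (θ k)), circleDiagonal_mem_archLocal_diagonal L 3 α w _⟩ * g⁻¹ : archLocal L 3 (Matrix.diagonal α) w) : GL (Fin 3) ℂ) : Matrix (Fin 3) (Fin 3) ℂ) ∂ν))) (𝓝[{θ : Fin 3 → ℝ | θ 1 < θ 2 ∧ θ 2 < θ 0} ∩ ball (0 : Fin 3 → ℝ) r] x) (𝓝 R) := by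
    intro k hk x hx
    obtain ⟨M', hM'⟩ := hbS (k + 1) (Nat.succ_le_of_lt hk)
    exact exists_tendsto_iteratedFDeriv_nhdsWithin_closure hKSo hKSc (hFS'.of_le (by exact_mod_cast (by omega : k + 1 ≤ 4))) hM' hx
  have hlimD : ∀ k : ℕ, k < 4 → ∀ x ∈ closure ({θ : Fin 3 → ℝ | θ 1 < θ 0 ∧ θ 0 < θ 2} ∩ ball (0 : Fin 3 → ℝ) r), ∃ R : ContinuousMultilinearMap ℝ (fun _ : Fin k => Fin 3 → ℝ) ℂ,
      Tendsto (iteratedFDeriv ℝ k (fun θ : Fin 3 → ℝ => ((((ζ * Circle.exp (θ 0) : Circle) : ℂ)) * (((ζ * Circle.exp (θ 2) : Circle) : ℂ))⁻¹) * ((1 - (((ζ * Circle.exp (θ 1) : Circle) : ℂ)) * (((ζ * Circle.exp (θ 0) : Circle) : ℂ))⁻¹) * (1 - (((ζ * Circle.exp (θ 2) : Circle) : ℂ)) * (((ζ * Circle.exp (θ 1) : Circle) : ℂ))⁻¹) * (1 - (((ζ * Circle.exp (θ 2) : Circle) : ℂ)) * (((ζ * Circle.exp (θ 0) : Circle) :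 ℂ))⁻¹)) * (∫ g, Θ (((g * ⟨circleDiagonal 3 (fun k => ζ * Circle.exp (θ k)), circleDiagonal_mem_archLocal_diagonal L 3 α w _⟩ * g⁻¹ : archLocal L 3 (Matrix.diagonal α) w) : GL (Fin 3) ℂ) : Matrix (Fin 3) (Fin 3) ℂ) ∂ν))) (𝓝[{θ : Fin 3 → ℝ | θ 1 < θ 0 ∧ θ 0 < θ 2} ∩ ball (0 : Fin 3 → ℝ) r] x) (𝓝 R) := by
    intro k hk x hx
    obtain ⟨M', hM'⟩ := hbD (k + 1) (Nat.succ_le_of_lt hk)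
    exact exists_tendsto_iteratedFDeriv_nhdsWithin_closure hKDo hKDc (hFD'.of_le (by exact_mod_cast (by omega : k + 1 ≤ 4))) hM' hx
  -- the corner limit on `D` and its value; the given corner limit on `S⁻` within the cut region
  obtain ⟨J', hJ'⟩ := hlimD 3 (by norm_num) 0 h0D
  have hballmem : ball (0 : Fin 3 → ℝ) r ∈ 𝓝 (0 : Fin 3 → ℝ) := ball_mem_nhds 0 hr
  have hV' : (1 / 48 : ℂ) * ∑ ε : Fin 3 → Bool, ((((if ε 0 then (1 : ℝ) else -1) * (if ε 1 then (1 : ℝ) else -1) * (if ε 2 then (1 : ℝ) else -1) : ℝ)) : ℂ) * J' (fun _ : Fin 3 => ![(if ε 0 then (1 : ℝ) else -1) + (if ε 1 then (1 : ℝ) else -1), -(if ε 0 then (1 : ℝ) else -1) + (if ε 2 then (1 : ℝ) else -1), -(if ε 1 then (1 : ℝ) else -1) - (if ε 2 then (1 : ℝ) else -1)]) = V := by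
    refine hD J' ?_
    rwa [nhdsWithin_inter_of_mem' (mem_nhdsWithin_of_mem_nhds hballmem)] at hJ'
  have hJS : Tendsto (iteratedFDeriv ℝ 3 (fun θ : Fin 3 → ℝ => ((((ζ * Circle.exp (θ 0) : Circle) : ℂ)) * (((ζ * Circle.exp (θ 2) : Circle) : ℂ))⁻¹) * ((1 - (((ζ * Circle.exp (θ 1) : Circle) : ℂ)) * (((ζ * Circle.exp (θ 0) : Circle) : ℂ))⁻¹) * (1 - (((ζ * Circle.exp (θ 2) : Circle) : ℂ)) * (((ζ * Circle.exp (θ 1) : Circle) : ℂ))⁻¹) * (1 - (((ζ * Circle.exp (θ 2) : Circle) : ℂ)) * (((ζ * Circle.exp (θ 0) : Circle) : ℂ))⁻¹)) * (∫ g, Θ (((g * ⟨circleDiagonal 3 (fun k => ζ * Circle.exp (θ k)), circleDiagonal_mem_archLocal_diagonal L 3 α w _⟩ * g⁻¹ : archLocal L 3 (Matrix.diagonal α) w) : GL (Fin 3) ℂ) : Matrix (Fin 3) (Fin 3) ℂ) ∂ν))) (𝓝[{θ : Fin 3 → ℝ | θ 1 < θ 2 ∧ θ 2 < θ 0} ∩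 ball (0 : Fin 3 → ℝ) r] 0) (𝓝 J) := by
    rwa [nhdsWithin_inter_of_mem' (mem_nhdsWithin_of_mem_nhds hballmem)]
  -- semiregularity of the wall points `tA′`, `0 < t < r∕4 ≤ 1∕4`
  have hcos : ∀ t ∈ Ioo (0 : ℝ) (r / 4), Real.cos (3 * t) ≠ 1 := by
    intro t ht
    refine cos_three_mul_ne_one_of_abs_lt (ne_of_gt ht.1) ?_
    rw [abs_of_pos ht.1]
    have hπ : (3 : ℝ) < Real.pi := Real.pi_gt_three
    linarith [ht.2]
  -- (J-nc) at the wall points (CM field; ★ centraliser Haar measure; ★ `archLimitFormulaNoncompactWall_holds`) — VERBATIM the ★ (J3-odd)₁ CM packaging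
  have hJnc : ∀ t ∈ Ioo (0 : ℝ) (r / 4), ∃ Lim : ℂ, Tendsto (fun ψ : ℝ => deriv (fun ψ : ℝ => (2 * Real.sin ψ : ℂ) * (fun z : Fin 3 → Circle => ∫ g, Θ (((g * ⟨circleDiagonal 3 z, circleDiagonal_mem_archLocal_diagonal L 3 α w z⟩ * g⁻¹ : archLocal L 3 (Matrix.diagonal α) w) : GL (Fin 3) ℂ) : Matrix (Fin 3) (Fin 3) ℂ) ∂ν) (fun i : Fin 3 => ζ * Circle.exp ((t • (![1, -2, 1] : Fin 3 → ℝ)) i) * Circle.exp ((![(1 : ℝ), 0, -1] : Fin 3 → ℝ) i * ψ))) ψ) (𝓝[≠] 0) (𝓝 Lim) := by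
    intro t ht
    have h02 := angleChart_wall02_apply_zero_eq_two ζ t
    have h01 := angleChart_wall02_apply_zero_ne_one ζ (hcos t ht)
    obtain ⟨νH, hνH, -, hνHinv⟩ := exists_isHaarMeasure_isInvInvariant_centralizer_circleDiagonal_wall L α w hα hreal
      (z₁ := fun k : Fin 3 => ζ * Circle.exp ((t • (![1, -2, 1] : Fin 3 → ℝ)) k)) h02 h01
    haveI := hνH
    haveI := hνHinv
    letI : MeasurableSpace (archLocal L 3 (Matrix.diagonal α) w ⧸ Subgroup.centralizer
        ({(⟨circleDiagonal 3 (fun k : Fin 3 => ζ * Circle.exp ((t • (![1, -2, 1] : Fin 3 → ℝ)) k)),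
          circleDiagonal_mem_archLocal_diagonal L 3 α w _⟩ : archLocal L 3 (Matrix.diagonal α) w)} : Set (archLocal L 3 (Matrix.diagonal α) w))) := borel _
    haveI : BorelSpace (archLocal L 3 (Matrix.diagonal α) w ⧸ Subgroup.centralizer
        ({(⟨circleDiagonal 3 (fun k : Fin 3 => ζ * Circle.exp ((t • (![1, -2, 1] : Fin 3 → ℝ)) k)),
          circleDiagonal_mem_archLocal_diagonal L 3 α w _⟩ : archLocal L 3 (Matrix.diagonal α) w)} : Set (archLocal L 3 (Matrix.diagonal α) w))) := ⟨rfl⟩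
    obtain ⟨c, -, hc⟩ := archLimitFormulaNoncompactWall_holds L α w hα hreal ν
      (fun k : Fin 3 => ζ * Circle.exp ((t • (![1, -2, 1] : Fin 3 → ℝ)) k)) h02 h01 hsgn νH
    exact ⟨_, hc Θ hΘ hΘc (fun k : Fin 3 => ζ * Circle.exp ((t • (![1, -2, 1] : Fin 3 → ℝ)) k)) h02 h01⟩
  -- the factorisation of `F` along the normal line: `F(tA′+sN′) = r(s)·g_t(s)`
  have hfac : ∀ t s : ℝ, (fun θ : Fin 3 → ℝ => ((((ζ * Circle.exp (θ 0) : Circle) : ℂ)) * (((ζ * Circle.exp (θ 2) : Circle) : ℂ))⁻¹) * ((1 - (((ζ * Circle.exp (θ 1) : Circle) : ℂ)) * (((ζ * Circle.exp (θ 0) : Circle) : ℂ))⁻¹) * (1 - (((ζ * Circle.exp (θ 2) : Circle) : ℂ)) * (((ζ * Circle.exp (θ 1) : Circle) : ℂ))⁻¹) * (1 - (((ζ * Circle.exp (θ 2) : Circle) : ℂ)) * (((ζ * Circle.exp (θ 0) : Circle) : ℂ))⁻¹)) * (∫ g, Θ (((g * ⟨circleDiagonal 3 (fun k => ζ * Circle.exp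 (θ k)), circleDiagonal_mem_archLocal_diagonal L 3 α w _⟩ * g⁻¹ : archLocal L 3 (Matrix.diagonal α) w) : GL (Fin 3) ℂ) : Matrix (Fin 3) (Fin 3) ℂ) ∂ν)) (t • (![1, -2, 1] : Fin 3 → ℝ) + s • (![1, 0, -1] : Fin 3 → ℝ)) = (Complex.I * (2 * Real.cos s - 2 * Real.cos (3 * t) : ℂ)) * (fun ψ : ℝ => (2 * Real.sin ψ : ℂ) * (fun z : Fin 3 → Circle => ∫ g, Θ (((g * ⟨circleDiagonal 3 z, circleDiagonal_mem_archLocal_diagonal L 3 α w z⟩ * g⁻¹ : archLocal L 3 (Matrix.diagonal α) w) : GL (Fin 3) ℂ) : Matrix (Fin 3) (Fin 3) ℂ) ∂ν) (fun i : Fin 3 => ζ * Circle.exp ((t • (![1, -2, 1] : Fin 3 → ℝ)) i) * Circle.exp ((![(1 : ℝ), 0, -1] : Fin 3 → ℝ) i * ψ))) s := by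
    intro t s
    beta_reduce
    rw [rhoWeylDelta_angleChart_wall02_line ζ t s, angleChart_wall02_line_eq_curve ζ t s]
    ring
  -- the two wall hypotheses of the corner transfer
  have hfirst : ∀ t ∈ Ioo (0 : ℝ) (r / 4), ∀ P Q : ContinuousMultilinearMap ℝ (fun _ : Fin 1 => Fin 3 → ℝ) ℂ,
      Tendsto (iteratedFDeriv ℝ 1 (fun θ : Fin 3 → ℝ => ((((ζ * Circle.exp (θ 0) : Circle) : ℂ)) * (((ζ * Circle.exp (θ 2) : Circle) : ℂ))⁻¹) * ((1 - (((ζ * Circle.exp (θ 1) : Circle) : ℂ)) * (((ζ * Circle.exp (θ 0) : Circle) : ℂ))⁻¹) * (1 - (((ζ * Circle.exp (θ 2) : Circle) : ℂ)) * (((ζ * Circle.exp (θ 1) : Circle) : ℂ))⁻¹) * (1 - (((ζ * Circle.exp (θ 2) : Circle) : ℂ)) * (((ζ * Circle.exp (θ 0) : Circle) : ℂ))⁻¹)) * (∫ g, Θ (((g * ⟨circleDiagonal 3 (fun k => ζ * Circle.exp (θ k)), circleDiagonal_mem_archLocal_diagonal L 3 α w _⟩ * g⁻¹ : archLocal L 3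 (Matrix.diagonal α) w) : GL (Fin 3) ℂ) : Matrix (Fin 3) (Fin 3) ℂ) ∂ν))) (𝓝[{θ : Fin 3 → ℝ | θ 1 < θ 2 ∧ θ 2 < θ 0} ∩ ball (0 : Fin 3 → ℝ) r] (t • (![1, -2, 1] : Fin 3 → ℝ))) (𝓝 P) →
      Tendsto (iteratedFDeriv ℝ 1 (fun θ : Fin 3 → ℝ => ((((ζ * Circle.exp (θ 0) : Circle) : ℂ)) * (((ζ * Circle.exp (θ 2) : Circle) : ℂ))⁻¹) * ((1 - (((ζ * Circle.exp (θ 1) : Circle) : ℂ)) * (((ζ * Circle.exp (θ 0) : Circle) : ℂ))⁻¹) * (1 - (((ζ * Circle.exp (θ 2) : Circle) : ℂ)) * (((ζ * Circle.exp (θ 1) : Circle) : ℂ))⁻¹) * (1 - (((ζ * Circle.exp (θ 2) : Circle) : ℂ)) * (((ζ * Circle.exp (θ 0) : Circle) : ℂ))⁻¹)) * (∫ g, Θ (((g * ⟨circleDiagonal 3 (fun k => ζ * Circle.exp (θ k)), circleDiagonal_mem_archLocal_diagonal L 3 α w _⟩ * g⁻¹ : archLocal L 3 (Matrix.diagonal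 α) w) : GL (Fin 3) ℂ) : Matrix (Fin 3) (Fin 3) ℂ) ∂ν))) (𝓝[{θ : Fin 3 → ℝ | θ 1 < θ 0 ∧ θ 0 < θ 2} ∩ ball (0 : Fin 3 → ℝ) r] (t • (![1, -2, 1] : Fin 3 → ℝ))) (𝓝 Q) → P ![(![1, 0, -1] : Fin 3 → ℝ)] = Q ![(![1, 0, -1] : Fin 3 → ℝ)] := by
    intro t ht P Q hP hQ
    obtain ⟨hwS, hwD⟩ := wall02_point_mem_closure hr ht.1 ht.2
    obtain ⟨R₀, hR₀⟩ := hlimS 0 (by norm_num) _ hwS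
    obtain ⟨R₀', hR₀'⟩ := hlimD 0 (by norm_num) _ hwD
    exact wall02_firstJet_boundaryLimits_eq (fun θ : Fin 3 → ℝ => ((((ζ * Circle.exp (θ 0) : Circle) : ℂ)) * (((ζ * Circle.exp (θ 2) : Circle) : ℂ))⁻¹) * ((1 - (((ζ * Circle.exp (θ 1) : Circle) : ℂ)) * (((ζ * Circle.exp (θ 0) : Circle) : ℂ))⁻¹) * (1 - (((ζ * Circle.exp (θ 2) : Circle) : ℂ)) * (((ζ * Circle.exp (θ 1) : Circle) : ℂ))⁻¹) * (1 - (((ζ * Circle.exp (θ 2) : Circle) : ℂ)) * (((ζ * Circle.exp (θ 0) : Circle) : ℂ))⁻¹)) * (∫ g, Θ (((g * ⟨circleDiagonal 3 (fun k => ζ * Circle.exp (θ k)), circleDiagonal_mem_archLocal_diagonal L 3 α w _⟩ * g⁻¹ : archLocal L 3 (Matrix.diagonal α) w) : GL (Fin 3) ℂ) : Matrix (Fin 3) (Fin 3) ℂ) ∂ν)) hKSo hKDo (hFS'.of_le (by norm_num)) (hFD'.of_le (by norm_num)) t (hcos t ht)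
      (fun ψ : ℝ => (2 * Real.sin ψ : ℂ) * (fun z : Fin 3 → Circle => ∫ g, Θ (((g * ⟨circleDiagonal 3 z, circleDiagonal_mem_archLocal_diagonal L 3 α w z⟩ * g⁻¹ : archLocal L 3 (Matrix.diagonal α) w) : GL (Fin 3) ℂ) : Matrix (Fin 3) (Fin 3) ℂ) ∂ν) (fun i : Fin 3 => ζ * Circle.exp ((t • (![1, -2, 1] : Fin 3 → ℝ)) i) * Circle.exp ((![(1 : ℝ), 0, -1] : Fin 3 → ℝ) i * ψ))) (hfac t)
      (eventually_wall02_line_mem_Sminus hr ht.1 ht.2) (eventually_wall02_line_mem_D hr ht.1 ht.2)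
      (tendsto_of_tendsto_iteratedFDeriv_zero hR₀) (tendsto_of_tendsto_iteratedFDeriv_zero hR₀') (hJnc t ht) hP hQ
  have hthird : ∀ t ∈ Ioo (0 : ℝ) (r / 4), ∀ P Q : ContinuousMultilinearMap ℝ (fun _ : Fin 3 => Fin 3 → ℝ) ℂ,
      Tendsto (iteratedFDeriv ℝ 3 (fun θ : Fin 3 → ℝ => ((((ζ * Circle.exp (θ 0) : Circle) : ℂ)) * (((ζ * Circle.exp (θ 2) : Circle) : ℂ))⁻¹) * ((1 - (((ζ * Circle.exp (θ 1) : Circle) : ℂ)) * (((ζ * Circle.exp (θ 0) : Circle) : ℂ))⁻¹) * (1 - (((ζ * Circle.exp (θ 2) : Circle) : ℂ)) * (((ζ * Circle.exp (θ 1) : Circle) : ℂ))⁻¹) * (1 - (((ζ * Circle.exp (θ 2) : Circle) : ℂ)) * (((ζ * Circle.exp (θ 0) : Circle) : ℂ))⁻¹)) * (∫ g, Θ (((g * ⟨circleDiagonal 3 (fun k => ζ * Circle.exp (θ k)), circleDiagonal_mem_archLocal_diagonal L 3 α w _⟩ * g⁻¹ : archLocal L 3 (Matrix.diagonal α) w)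 : GL (Fin 3) ℂ) : Matrix (Fin 3) (Fin 3) ℂ) ∂ν))) (𝓝[{θ : Fin 3 → ℝ | θ 1 < θ 2 ∧ θ 2 < θ 0} ∩ ball (0 : Fin 3 → ℝ) r] (t • (![1, -2, 1] : Fin 3 → ℝ))) (𝓝 P) →
      Tendsto (iteratedFDeriv ℝ 3 (fun θ : Fin 3 → ℝ => ((((ζ * Circle.exp (θ 0) : Circle) : ℂ)) * (((ζ * Circle.exp (θ 2) : Circle) : ℂ))⁻¹) * ((1 - (((ζ * Circle.exp (θ 1) : Circle) : ℂ)) * (((ζ * Circle.exp (θ 0) : Circle) : ℂ))⁻¹) * (1 - (((ζ * Circle.exp (θ 2) : Circle) : ℂ)) * (((ζ * Circle.exp (θ 1) : Circle) : ℂ))⁻¹) * (1 - (((ζ * Circle.exp (θ 2) : Circle) : ℂ)) * (((ζ * Circle.exp (θ 0) : Circle) : ℂ))⁻¹)) * (∫ g, Θ (((g * ⟨circleDiagonal 3 (fun k => ζ * Circle.exp (θ k)), circleDiagonal_mem_archLocal_diagonal L 3 α w _⟩ * g⁻¹ : archLocal L 3 (Matrix.diagonal α) w) : GL (Fin 3)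 ℂ) : Matrix (Fin 3) (Fin 3) ℂ) ∂ν))) (𝓝[{θ : Fin 3 → ℝ | θ 1 < θ 0 ∧ θ 0 < θ 2} ∩ ball (0 : Fin 3 → ℝ) r] (t • (![1, -2, 1] : Fin 3 → ℝ))) (𝓝 Q) → P ![(![1, 0, -1] : Fin 3 → ℝ), (![1, 0, -1] : Fin 3 → ℝ), (![1, 0, -1] : Fin 3 → ℝ)] = Q ![(![1, 0, -1] : Fin 3 → ℝ), (![1, 0, -1] : Fin 3 → ℝ), (![1, 0, -1] : Fin 3 → ℝ)] := by
    intro t ht P Q hP hQ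
    have hcube := wall02_cubeLimit L α w hsgn hα hreal ν Θ hΘ hΘc ζ t (hcos t ht)
    exact wall02_thirdJet_boundaryLimits_eq (fun θ : Fin 3 → ℝ => ((((ζ * Circle.exp (θ 0) : Circle) : ℂ)) * (((ζ * Circle.exp (θ 2) : Circle) : ℂ))⁻¹) * ((1 - (((ζ * Circle.exp (θ 1) : Circle) : ℂ)) * (((ζ * Circle.exp (θ 0) : Circle) : ℂ))⁻¹) * (1 - (((ζ * Circle.exp (θ 2) : Circle) : ℂ)) * (((ζ * Circle.exp (θ 1) : Circle) : ℂ))⁻¹) * (1 - (((ζ * Circle.exp (θ 2) : Circle) : ℂ)) * (((ζ * Circle.exp (θ 0) : Circle) : ℂ))⁻¹)) * (∫ g, Θ (((g * ⟨circleDiagonal 3 (fun k => ζ * Circle.exp (θ k)), circleDiagonal_mem_archLocal_diagonal L 3 α w _⟩ * g⁻¹ : archLocal L 3 (Matrix.diagonal α) w) : GL (Fin 3) ℂ) : Matrix (Fin 3) (Fin 3) ℂ) ∂ν)) hKSo hKDo (hFS'.of_le (by norm_num)) (hFD'.of_le (by norm_num)) t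
      (eventually_wall02_line_mem_Sminus hr ht.1 ht.2) (eventually_wall02_line_mem_D hr ht.1 ht.2) hcube hP hQ
  -- THE CORNER TRANSFER
  obtain ⟨hNNN, hAAN⟩ := cornerJet_transfer hKSo hKSc hKDo hKDc
    (fun x hx y hy => norm_sub_le_of_mem_inter_ball x hx y hy) (fun x hx y hy => norm_sub_le_of_mem_inter_ball x hx y hy)
    hFS' hFD' hMS' hMD' h0S h0D (![1, -2, 1] : Fin 3 → ℝ) (![1, 0, -1] : Fin 3 → ℝ) (δ := r / 4) (by positivity)
    (fun t ht => (wall02_point_mem_closure hr ht.1 ht.2).1) (fun t ht => (wall02_point_mem_closure hr ht.1 ht.2).2)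
    (fun t ht => eventually_segment_wall02_mem hr ht.2 1 2 0 segment_mono_Sminus)
    (fun t ht => eventually_segment_wall02_mem hr ht.2 1 0 2 segment_mono_D)
    hfirst hthird hJS hJ'
  -- symmetry and polarisation
  have hsymJ := symmetric_of_tendsto_iteratedFDeriv_three hKSo (hFS'.of_le (by norm_num)) h0S hJS
  have hsymJ' := symmetric_of_tendsto_iteratedFDeriv_three hKDo (hFD'.of_le (by norm_num)) h0D hJ'
  have eS := sum_sign_cube_signedRay_eq_wall02_of_symmetric J hsymJ
  have eD := sum_sign_cube_signedRay_eq_wall02_of_symmetric J' hsymJ'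
  rw [← hV', eS, eD, hNNN, hAAN]

end Sminus

/-! ## §5 The jet reflection `θ ↦ −θ` (FILE 2's mechanism, any chamber): the value on `C_σ` for `(Θ, ζ)` from the value on `−C_σ = C_{σ·(0 2)}` for `(Θ^∨, ζ⁻¹)` -/

section Reflect

variable (L : Type) [Field L] (α : Fin 3 → L) (w : {w : InfinitePlace L // IsComplex w})

/-- **JET REFLECTION, ANY CHAMBER** (★ FILE 2 `chamberValue_max_of_min` without its `σ 0 = 2` bookkeeping): fix `ν` and a constant `c`; IF the value clause `Λ(J′) = −(c·i)·Θ′(ζ′•1)` holds for EVERY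
test function `Θ′`, every `ζ′` and every corner limit `J′` of the third jet within the chamber `C_{σ·(0 2)} = −C_σ`, THEN it holds on `C_σ` for every `Θ, ζ, J` — apply the hypothesis to
`Θ^∨`, `ζ⁻¹`, `Ψ(J)` (★ `letterDensity_comp_adj_angleChart`, ★ `iteratedFDeriv_neg_comp_neg`, ★ `comp_adj_apply_coe`).  Used for `S⁺ = [0,2,1] ↦ S⁻ = [1,2,0]`.
[cite: Rogawski1990, §8.4 pp. 126–127] [cite: HarishChandra1975HARRG1, §17 Lemma 17.5] -/
theorem chamberValue_of_reflect [MeasurableSpace (archLocal L 3 (Matrix.diagonal α) w)] [BorelSpace (archLocal L 3 (Matrix.diagonal α) w)]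
    (hα : ∀ i, α i ≠ 0) (ν : Measure (archLocal L 3 (Matrix.diagonal α) w)) (c : ℝ) (σ : Equiv.Perm (Fin 3))
    (hrefl : ∀ (Θ' : Matrix (Fin 3) (Fin 3) ℂ → ℂ), ContDiff ℝ (⊤ : ℕ∞) Θ' →
      HasCompactSupport (fun k : archLocal L 3 (Matrix.diagonal α) w => Θ' ((k : GL (Fin 3) ℂ) : Matrix (Fin 3) (Fin 3) ℂ)) →
      ∀ (ζ' : Circle) (J : ContinuousMultilinearMap ℝ (fun _ : Fin 3 => Fin 3 → ℝ) ℂ),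
        Tendsto (iteratedFDeriv ℝ 3 (fun θ : Fin 3 → ℝ => ((((ζ' * Circle.exp (θ 0) : Circle) : ℂ)) * (((ζ' * Circle.exp (θ 2) : Circle) : ℂ))⁻¹) * ((1 - (((ζ' * Circle.exp (θ 1) : Circle) : ℂ)) * (((ζ' * Circle.exp (θ 0) : Circle) : ℂ))⁻¹) * (1 - (((ζ' * Circle.exp (θ 2) : Circle) : ℂ)) * (((ζ' * Circle.exp (θ 1) : Circle) : ℂ))⁻¹) * (1 - (((ζ' * Circle.exp (θ 2) : Circle) : ℂ)) * (((ζ' * Circle.exp (θ 0) : Circle) : ℂ))⁻¹)) * (∫ g, Θ' (((g * ⟨circleDiagonal 3 (fun k => ζ' * Circle.exp (θ k)), circleDiagonal_mem_archLocal_diagonal L 3 α w _⟩ * g⁻¹ : archLocal L 3 (Matrix.diagonal α) w) : GL (Fin 3) ℂ) : Matrix (Fin 3) (Fin 3) ℂ) ∂ν))) (𝓝[{θ : Fin 3 → ℝ | θ ((σ * Equiv.swap (0 : Fin 3) 2) 0) < θ ((σ * Equiv.swap (0 : Fin 3) 2) 1) ∧ θ ((σ * Equiv.swap (0 : Fin 3)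 2) 1) < θ ((σ * Equiv.swap (0 : Fin 3) 2) 2)}] 0) (𝓝 J) →
          (1 / 48 : ℂ) * ∑ ε : Fin 3 → Bool, ((((if ε 0 then (1 : ℝ) else -1) * (if ε 1 then (1 : ℝ) else -1) * (if ε 2 then (1 : ℝ) else -1) : ℝ)) : ℂ) * J (fun _ : Fin 3 => ![(if ε 0 then (1 : ℝ) else -1) + (if ε 1 then (1 : ℝ) else -1), -(if ε 0 then (1 : ℝ) else -1) + (if ε 2 then (1 : ℝ) else -1), -(if ε 1 then (1 : ℝ) else -1) - (if ε 2 then (1 : ℝ) else -1)]) = -((c : ℂ) * Complex.I) * Θ' ((circleDiagonal 3 (fun _ => ζ') : GL (Fin 3) ℂ) : Matrix (Fin 3) (Fin 3) ℂ))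
    (Θ : Matrix (Fin 3) (Fin 3) ℂ → ℂ) (hΘ : ContDiff ℝ (⊤ : ℕ∞) Θ)
    (hΘc : HasCompactSupport (fun k : archLocal L 3 (Matrix.diagonal α) w => Θ ((k : GL (Fin 3) ℂ) : Matrix (Fin 3) (Fin 3) ℂ)))
    (ζ : Circle) (J : ContinuousMultilinearMap ℝ (fun _ : Fin 3 => Fin 3 → ℝ) ℂ)
    (hJ : Tendsto (iteratedFDeriv ℝ 3 (fun θ : Fin 3 → ℝ => ((((ζ * Circle.exp (θ 0) : Circle) : ℂ)) * (((ζ * Circle.exp (θ 2) : Circle) : ℂ))⁻¹) * ((1 - (((ζ * Circle.exp (θ 1) : Circle) : ℂ)) * (((ζ * Circle.exp (θ 0) : Circle) : ℂ))⁻¹) * (1 - (((ζ * Circle.exp (θ 2) : Circle) : ℂ)) * (((ζ * Circle.exp (θ 1) : Circle) : ℂ))⁻¹) * (1 - (((ζ * Circle.exp (θ 2) : Circle) : ℂ)) * (((ζ * Circle.exp (θ 0) : Circle) : ℂ))⁻¹)) * (∫ g, Θ (((g * ⟨circleDiagonal 3 (fun k => ζ * Circle.exp (θ k)), circleDiagonal_mem_archLocal_diagonal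 L 3 α w _⟩ * g⁻¹ : archLocal L 3 (Matrix.diagonal α) w) : GL (Fin 3) ℂ) : Matrix (Fin 3) (Fin 3) ℂ) ∂ν))) (𝓝[{θ : Fin 3 → ℝ | θ (σ 0) < θ (σ 1) ∧ θ (σ 1) < θ (σ 2)}] 0) (𝓝 J)) :
    (1 / 48 : ℂ) * ∑ ε : Fin 3 → Bool, ((((if ε 0 then (1 : ℝ) else -1) * (if ε 1 then (1 : ℝ) else -1) * (if ε 2 then (1 : ℝ) else -1) : ℝ)) : ℂ) * J (fun _ : Fin 3 => ![(if ε 0 then (1 : ℝ) else -1) + (if ε 1 then (1 : ℝ) else -1), -(if ε 0 then (1 : ℝ) else -1) + (if ε 2 then (1 : ℝ) else -1), -(if ε 1 then (1 : ℝ) else -1) - (if ε 2 then (1 : ℝ) else -1)]) = -((c : ℂ) * Complex.I) * Θ ((circleDiagonal 3 (fun _ => ζ) : GL (Fin 3) ℂ) : Matrix (Fin 3) (Fin 3) ℂ) := by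
  have hσ' : (σ * Equiv.swap (0 : Fin 3) 2) 0 = σ 2 := by rw [Equiv.Perm.mul_apply, Equiv.swap_apply_left]
  have hσ'1 : (σ * Equiv.swap (0 : Fin 3) 2) 1 = σ 1 := by rw [Equiv.Perm.mul_apply, Equiv.swap_apply_of_ne_of_ne (by decide) (by decide)]
  have hσ'2 : (σ * Equiv.swap (0 : Fin 3) 2) 2 = σ 0 := by rw [Equiv.Perm.mul_apply, Equiv.swap_apply_right]
  -- the reflected letter function is `θ ↦ −F_Θ∘chart_ζ(−θ)`
  have hGF : (fun θ : Fin 3 → ℝ => ((((ζ⁻¹ * Circle.exp (θ 0) : Circle) : ℂ)) * (((ζ⁻¹ * Circle.exp (θ 2) : Circle) : ℂ))⁻¹) * ((1 - (((ζ⁻¹ * Circle.exp (θ 1) : Circle) : ℂ)) * (((ζ⁻¹ * Circle.exp (θ 0) : Circle) : ℂ))⁻¹) * (1 - (((ζ⁻¹ * Circle.exp (θ 2) : Circle) : ℂ)) * (((ζ⁻¹ * Circle.exp (θ 1) : Circle) : ℂ))⁻¹) * (1 - (((ζ⁻¹ * Circle.exp (θ 2) : Circle) : ℂ)) * (((ζ⁻¹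 * Circle.exp (θ 0) : Circle) : ℂ))⁻¹)) * (∫ g, Θ (Matrix.diagonal (fun i : Fin 3 => (w.1.embedding (α i))⁻¹) * (((g * ⟨circleDiagonal 3 (fun k => ζ⁻¹ * Circle.exp (θ k)), circleDiagonal_mem_archLocal_diagonal L 3 α w _⟩ * g⁻¹ : archLocal L 3 (Matrix.diagonal α) w) : GL (Fin 3) ℂ) : Matrix (Fin 3) (Fin 3) ℂ)ᴴ * Matrix.diagonal (fun i : Fin 3 => w.1.embedding (α i))) ∂ν)) =
      fun θ : Fin 3 → ℝ => -((fun θ : Fin 3 → ℝ => ((((ζ * Circle.exp (θ 0) : Circle) : ℂ)) * (((ζ * Circle.exp (θ 2) : Circle) : ℂ))⁻¹) * ((1 - (((ζ * Circle.exp (θ 1) : Circle) : ℂ)) * (((ζ * Circle.exp (θ 0) : Circle) : ℂ))⁻¹) * (1 - (((ζ * Circle.exp (θ 2) : Circle) : ℂ)) * (((ζ * Circle.exp (θ 1) : Circle) : ℂ))⁻¹) * (1 - (((ζ * Circle.exp (θ 2) : Circle) : ℂ)) * (((ζ * Circle.exp (θ 0) : Circle) : ℂ))⁻¹)) * (∫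 g, Θ (((g * ⟨circleDiagonal 3 (fun k => ζ * Circle.exp (θ k)), circleDiagonal_mem_archLocal_diagonal L 3 α w _⟩ * g⁻¹ : archLocal L 3 (Matrix.diagonal α) w) : GL (Fin 3) ℂ) : Matrix (Fin 3) (Fin 3) ℂ) ∂ν)) (-θ)) := by
    funext θ
    exact letterDensity_comp_adj_angleChart L α w hα ν Θ ζ θ
  have hjet : ∀ θ : Fin 3 → ℝ, iteratedFDeriv ℝ 3 (fun θ : Fin 3 → ℝ => ((((ζ⁻¹ * Circle.exp (θ 0) : Circle) : ℂ)) * (((ζ⁻¹ * Circle.exp (θ 2) : Circle) : ℂ))⁻¹) * ((1 - (((ζ⁻¹ * Circle.exp (θ 1) : Circle) : ℂ)) * (((ζ⁻¹ * Circle.exp (θ 0) : Circle) : ℂ))⁻¹) * (1 - (((ζ⁻¹ * Circle.exp (θ 2) : Circle) : ℂ)) * (((ζ⁻¹ * Circle.exp (θ 1) : Circle) : ℂ))⁻¹) * (1 - (((ζ⁻¹ * Circle.exp (θ 2) : Circle) : ℂ)) * (((ζ⁻¹ * Circle.exp (θ 0) : Circle) : ℂ))⁻¹)) * (∫ g, Θ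 (Matrix.diagonal (fun i : Fin 3 => (w.1.embedding (α i))⁻¹) * (((g * ⟨circleDiagonal 3 (fun k => ζ⁻¹ * Circle.exp (θ k)), circleDiagonal_mem_archLocal_diagonal L 3 α w _⟩ * g⁻¹ : archLocal L 3 (Matrix.diagonal α) w) : GL (Fin 3) ℂ) : Matrix (Fin 3) (Fin 3) ℂ)ᴴ * Matrix.diagonal (fun i : Fin 3 => w.1.embedding (α i))) ∂ν)) θ =
      -((iteratedFDeriv ℝ 3 (fun θ : Fin 3 → ℝ => ((((ζ * Circle.exp (θ 0) : Circle) : ℂ)) * (((ζ * Circle.exp (θ 2) : Circle) : ℂ))⁻¹) * ((1 - (((ζ * Circle.exp (θ 1) : Circle) : ℂ)) * (((ζ * Circle.exp (θ 0) : Circle) : ℂ))⁻¹) * (1 - (((ζ * Circle.exp (θ 2) : Circle) : ℂ)) * (((ζ * Circle.exp (θ 1) : Circle) : ℂ))⁻¹) * (1 - (((ζ * Circle.exp (θ 2) : Circle) : ℂ)) * (((ζ * Circle.exp (θ 0) : Circle) : ℂ))⁻¹)) * (∫ g, Θ (((g * ⟨circleDiagonal 3 (fun k => ζ * Circle.exp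 (θ k)), circleDiagonal_mem_archLocal_diagonal L 3 α w _⟩ * g⁻¹ : archLocal L 3 (Matrix.diagonal α) w) : GL (Fin 3) ℂ) : Matrix (Fin 3) (Fin 3) ℂ) ∂ν)) (-θ)).compContinuousLinearMap fun _ => ((ContinuousLinearEquiv.neg ℝ : (Fin 3 → ℝ) ≃L[ℝ] (Fin 3 → ℝ)) : (Fin 3 → ℝ) →L[ℝ] (Fin 3 → ℝ))) := by
    intro θ
    rw [hGF]
    exact iteratedFDeriv_neg_comp_neg (fun θ : Fin 3 → ℝ => ((((ζ * Circle.exp (θ 0) : Circle) : ℂ)) * (((ζ * Circle.exp (θ 2) : Circle) : ℂ))⁻¹) * ((1 - (((ζ * Circle.exp (θ 1) : Circle) : ℂ)) * (((ζ * Circle.exp (θ 0) : Circle) : ℂ))⁻¹) * (1 - (((ζ * Circle.exp (θ 2) : Circle) : ℂ)) * (((ζ * Circle.exp (θ 1) : Circle) : ℂ))⁻¹) * (1 - (((ζ * Circle.exp (θ 2) : Circle) : ℂ)) * (((ζ * Circle.exp (θ 0) : Circle) : ℂ))⁻¹)) * (∫ g, Θ (((g * ⟨circleDiagonal 3 (fun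 k => ζ * Circle.exp (θ k)), circleDiagonal_mem_archLocal_diagonal L 3 α w _⟩ * g⁻¹ : archLocal L 3 (Matrix.diagonal α) w) : GL (Fin 3) ℂ) : Matrix (Fin 3) (Fin 3) ℂ) ∂ν)) 3 θ
  have hneg : Tendsto (fun θ : Fin 3 → ℝ => -θ) (𝓝[{θ : Fin 3 → ℝ | θ ((σ * Equiv.swap (0 : Fin 3) 2) 0) < θ ((σ * Equiv.swap (0 : Fin 3) 2) 1) ∧ θ ((σ * Equiv.swap (0 : Fin 3) 2) 1) < θ ((σ * Equiv.swap (0 : Fin 3) 2) 2)}] 0) (𝓝[{θ : Fin 3 → ℝ | θ (σ 0) < θ (σ 1) ∧ θ (σ 1) < θ (σ 2)}] 0) := by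
    refine tendsto_nhdsWithin_iff.2 ⟨?_, ?_⟩
    · have h := ((continuous_neg (G := Fin 3 → ℝ)).tendsto (0 : Fin 3 → ℝ)).mono_left (nhdsWithin_le_nhds (s := {θ : Fin 3 → ℝ | θ ((σ * Equiv.swap (0 : Fin 3) 2) 0) < θ ((σ * Equiv.swap (0 : Fin 3) 2) 1) ∧ θ ((σ * Equiv.swap (0 : Fin 3) 2) 1) < θ ((σ * Equiv.swap (0 : Fin 3) 2) 2)}))
      rwa [neg_zero] at h
    · filter_upwards [self_mem_nhdsWithin] with θ hθ
      rw [hσ', hσ'1, hσ'2] at hθ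
      show (-θ) (σ 0) < (-θ) (σ 1) ∧ (-θ) (σ 1) < (-θ) (σ 2)
      simp only [Pi.neg_apply]
      exact ⟨neg_lt_neg hθ.2, neg_lt_neg hθ.1⟩
  have hJ' : Tendsto (iteratedFDeriv ℝ 3 (fun θ : Fin 3 → ℝ => ((((ζ⁻¹ * Circle.exp (θ 0) : Circle) : ℂ)) * (((ζ⁻¹ * Circle.exp (θ 2) : Circle) : ℂ))⁻¹) * ((1 - (((ζ⁻¹ * Circle.exp (θ 1) : Circle) : ℂ)) * (((ζ⁻¹ * Circle.exp (θ 0) : Circle) : ℂ))⁻¹) * (1 - (((ζ⁻¹ * Circle.exp (θ 2) : Circle) : ℂ)) * (((ζ⁻¹ * Circle.exp (θ 1) : Circle) : ℂ))⁻¹) * (1 - (((ζ⁻¹ * Circle.exp (θ 2) : Circle) : ℂ)) * (((ζ⁻¹ * Circle.exp (θ 0) : Circle) : ℂ))⁻¹)) * (∫ g, Θ (Matrix.diagonal (fun i : Fin 3 => (w.1.embedding (α i))⁻¹) * (((g * ⟨circleDiagonal 3 (fun k => ζ⁻¹ * Circle.exp (θ k)), circleDiagonal_mem_archLocal_diagonal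 L 3 α w _⟩ * g⁻¹ : archLocal L 3 (Matrix.diagonal α) w) : GL (Fin 3) ℂ) : Matrix (Fin 3) (Fin 3) ℂ)ᴴ * Matrix.diagonal (fun i : Fin 3 => w.1.embedding (α i))) ∂ν))) (𝓝[{θ : Fin 3 → ℝ | θ ((σ * Equiv.swap (0 : Fin 3) 2) 0) < θ ((σ * Equiv.swap (0 : Fin 3) 2) 1) ∧ θ ((σ * Equiv.swap (0 : Fin 3) 2) 1) < θ ((σ * Equiv.swap (0 : Fin 3) 2) 2)}] 0)
      (𝓝 (-(J.compContinuousLinearMap fun _ => ((ContinuousLinearEquiv.neg ℝ : (Fin 3 → ℝ) ≃L[ℝ] (Fin 3 → ℝ)) : (Fin 3 → ℝ) →L[ℝ] (Fin 3 → ℝ))))) := by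
    have h := ((continuous_neg_compContinuousLinearMap_neg (E := Fin 3 → ℝ) (F := ℂ) 3).tendsto J).comp (hJ.comp hneg)
    refine h.congr fun θ => ?_
    simp only [Function.comp_apply]
    exact (hjet θ).symm
  have key := hrefl (fun A : Matrix (Fin 3) (Fin 3) ℂ => Θ (Matrix.diagonal (fun i : Fin 3 => (w.1.embedding (α i))⁻¹) * Aᴴ * Matrix.diagonal (fun i : Fin 3 => w.1.embedding (α i)))) (contDiff_comp_adj L α w Θ hΘ) (hasCompactSupport_comp_adj L α w hα Θ hΘc) ζ⁻¹ _ hJ'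
  beta_reduce at key
  have hcen : Θ (Matrix.diagonal (fun i : Fin 3 => (w.1.embedding (α i))⁻¹) * ((circleDiagonal 3 (fun _ : Fin 3 => ζ⁻¹) : GL (Fin 3) ℂ) : Matrix (Fin 3) (Fin 3) ℂ)ᴴ * Matrix.diagonal (fun i : Fin 3 => w.1.embedding (α i))) =
      Θ ((circleDiagonal 3 (fun _ : Fin 3 => ζ) : GL (Fin 3) ℂ) : Matrix (Fin 3) (Fin 3) ℂ) := by
    have h := comp_adj_apply_coe L α w hα Θ (⟨circleDiagonal 3 (fun _ : Fin 3 => ζ⁻¹), circleDiagonal_mem_archLocal_diagonal L 3 α w _⟩ : archLocal L 3 (Matrix.diagonal α) w)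
    rw [Subgroup.coe_inv, ← map_inv] at h
    have hz : (fun _ : Fin 3 => ζ⁻¹)⁻¹ = fun _ : Fin 3 => ζ := by
      funext k
      rw [Pi.inv_apply, inv_inv]
    rw [hz] at h
    exact h
  simp only [neg_compContinuousLinearMap_neg_apply_const_three, hcen] at key
  exact key

end Reflect

end Literature.NumberTheory.Rogawski1990

end
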